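import Literature.GroupTheory.CombinatorialGroupTheory.RandomSclFreeGroupChunkMatching
import Literature.GroupTheory.CombinatorialGroupTheory.RandomSclFreeGroupChunkTypes
import Literature.GroupTheory.CombinatorialGroupTheory.RandomSclFreeGroupLowerTail
import HarnessLib

/-!
# Random rigidity of scl (Calegari–Walker 2013): proofs, part 12 — the upper tail (constant 1/4)

D. Calegari, A. Walker, *Random rigidity in the free group*, Geom. Topol. 17 (2013)
[CalegariWalker2013], Thm 4.1 / Prop. 4.2: `scl(v) · log n / n ≤ log(2k−1)/6 + ε` with probability
`1 − O(n^{−C})`. The printed proof glues tripods and rectangles (§4.3); here we certify the weaker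
constant `1/4` by the simplest fatgraph: cut `v` into consecutive chunks of length
`ℓ + 1 ≈ L log n / log(2k−1)` (`L < 1`) and match chunks of type `σ` with chunks of type `σ⁻¹`
(`commutatorLength_le_of_chunkCounts`); by the equidistribution of chunk types (Lemma 2.5, in the
form `card_filter_windowCount_ge_le`, and `discrepancy_le`) almost all chunks are matched, whence
`cl(v) ≤ n/(4(ℓ+1)) (1 + o(1))` and `scl ≤ cl`.

* **`four_mul_cl_le_of_goodChunks`** — deterministic: if every chunk-type count is `≤ U` then
  `4 cl(w) + 2 ℓ J ≤ n + 2 + ℓ |F_{ℓ+1}| U`, `J = ⌊(n−1)/(ℓ+1)⌋` the number of chunks.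
* **`card_filter_badChunks_le`**, **`card_filter_scl_gt_le`** — Lemma 2.5 for the odd / even
  chunks and the per-length bound transferred to `F_n'`.
* **`CalegariWalker2013_sclUpperTail_quarter`** — the upper tail:
  `#{v ∈ F_n' : scl(v) log n/n > log(2k−1)/4 + ε} ≤ K n^{−C} |F_n'|` eventually.
* **`CalegariWalker2013_sclOrderOfMagnitude`** — with `CalegariWalker2013_sclLowerTail`:
  `scl(v) log n / n ∈ [log(2k−1)/12 − ε, log(2k−1)/4 + ε]` off a set of proportion `K n^{−C}`.
-/

noncomputable section

open Filter Topology

namespace Literature.GroupTheory.CombinatorialGroupTheory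

section Deterministic

open scoped Classical

/-- The start of chunk `j` plus `ℓ` stays inside the word. [folklore] -/
theorem chunk_bound {n ℓ : ℕ} (j : Fin ((n - 1) / (ℓ + 1))) :
    1 + (j : ℕ) * (ℓ + 1) + ℓ < n := by
  have h1 : ((j : ℕ) + 1) * (ℓ + 1) ≤ (n - 1) / (ℓ + 1) * (ℓ + 1) :=
    Nat.mul_le_mul_right _ (Nat.succ_le_of_lt j.isLt)
  have h2 : (n - 1) / (ℓ + 1) * (ℓ + 1) ≤ n - 1 := Nat.div_mul_le_self _ _
  rw [add_mul, one_mul] at h1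
  omega

/-- **The chunk fatgraph, deterministic form.** Let `w ∈ F_n'` (reduced, in the commutator
subgroup), `ℓ ≥ 0`, `J = ⌊(n−1)/(ℓ+1)⌋` chunks `C_j = w[1 + j(ℓ+1), (j+1)(ℓ+1)]`, and suppose
every reduced word `σ` of length `ℓ + 1` is the type of at most `U` chunks. Then
`4 · cl(w) + 2 ℓ J ≤ n + 2 + ℓ · |F_{ℓ+1}| · U`. [cite: CalegariWalker2013, §4.3 (weak form)] -/
theorem four_mul_cl_le_of_goodChunks (k n ℓ : ℕ) {w : Fin n → Fin k × Bool}
    (hw : w ∈ commutatorWords k n) (U : ℕ)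
    (hU : ∀ σ ∈ reducedWords k (ℓ + 1),
      (Finset.univ.filter fun j : Fin ((n - 1) / (ℓ + 1)) =>
        (fun q : Fin (ℓ + 1) => w ⟨1 + (j : ℕ) * (ℓ + 1) + q, by
          have := chunk_bound j; omega⟩) = σ).card ≤ U) :
    4 * commutatorLength (FreeGroup.mk (List.ofFn w)) + 2 * ℓ * ((n - 1) / (ℓ + 1)) ≤
      n + 2 + ℓ * ((reducedWords k (ℓ + 1)).card * U) := by
  set J := (n - 1) / (ℓ + 1) with hJ
  have hwred : w ∈ reducedWords k n := commutatorWords_subset k n hw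
  have hwcomm : FreeGroup.mk (List.ofFn w) ∈ commutator (FreeGroup (Fin k)) :=
    ((mem_commutatorWords_iff w).mp hw).2
  -- the chunk starts
  set s : Fin J → ℕ := fun j => 1 + (j : ℕ) * (ℓ + 1) with hs
  have hsb : ∀ j, s j + ℓ < n := fun j => chunk_bound j
  have hdisj : ∀ j j' : Fin J, j ≠ j' → s j + ℓ < s j' ∨ s j' + ℓ < s j := by
    intro j j' hne
    rcases lt_or_gt_of_ne (Fin.val_ne_of_ne hne) with h | h
    · left
      have := Nat.mul_le_mul_right (ℓ + 1) (Nat.succ_le_of_lt h)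
      rw [Nat.succ_mul] at this
      show 1 + (j : ℕ) * (ℓ + 1) + ℓ < 1 + (j' : ℕ) * (ℓ + 1)
      omega
    · right
      have := Nat.mul_le_mul_right (ℓ + 1) (Nat.succ_le_of_lt h)
      rw [Nat.succ_mul] at this
      show 1 + (j' : ℕ) * (ℓ + 1) + ℓ < 1 + (j : ℕ) * (ℓ + 1)
      omega
  have hself : ∀ j, (fun q : Fin (ℓ + 1) => w ⟨s j + q, by have := hsb j; omega⟩) ≠
      fun q : Fin (ℓ + 1) => ((w ⟨s j + (ℓ - q), by have := hsb j; omega⟩).1,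
        !(w ⟨s j + (ℓ - q), by have := hsb j; omega⟩).2) :=
    fun j => chunk_ne_inv hwred (hsb j)
  have hmatch := commutatorLength_le_of_chunkCounts w hwcomm ℓ J s hsb hdisj hself
  -- the discrepancy
  have hdisc := discrepancy_le
    (fun j : Fin J => fun q : Fin (ℓ + 1) => w ⟨s j + q, by have := hsb j; omega⟩)
    (fun σ : Fin (ℓ + 1) → Fin k × Bool => fun q : Fin (ℓ + 1) =>
      ((σ ⟨ℓ - q, by omega⟩).1, !(σ ⟨ℓ - q, by omega⟩).2))
    (fun σ => by
      funext q
      simp only [Bool.not_not]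
      have e : (⟨ℓ - (ℓ - (q : ℕ)), by omega⟩ : Fin (ℓ + 1)) = q := Fin.ext (by simp only; omega)
      rw [e])
    (reducedWords k (ℓ + 1)) (fun j => window_mem_reducedWords hwred (hsb j))
    (fun σ hσ => invWord_mem_reducedWords hσ) U hU
  -- combine
  set D := ∑ σ ∈ (Finset.univ : Finset (Fin J)).image
      (fun j : Fin J => fun q : Fin (ℓ + 1) => w ⟨s j + q, by have := hsb j; omega⟩),
    ((Finset.univ.filter fun j : Fin J => (fun q : Fin (ℓ + 1) =>
        w ⟨s j + q, by have := hsb j; omega⟩) = σ).card -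
      (Finset.univ.filter fun j : Fin J => (fun q : Fin (ℓ + 1) =>
        w ⟨s j + q, by have := hsb j; omega⟩) = fun q : Fin (ℓ + 1) =>
          ((σ ⟨ℓ - q, by omega⟩).1, !(σ ⟨ℓ - q, by omega⟩).2)).card) with hD
  have h1 : 4 * commutatorLength (FreeGroup.mk (List.ofFn w)) + ℓ * (J - D) ≤ n + 2 := hmatch
  have h2 : D + J ≤ (reducedWords k (ℓ + 1)).card * U := hdisc
  have h3 : ℓ * J ≤ ℓ * (J - D) + ℓ * D := by
    rw [← Nat.mul_add]; exact Nat.mul_le_mul_left ℓ (by omega)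
  have h4 : ℓ * D + ℓ * J ≤ ℓ * ((reducedWords k (ℓ + 1)).card * U) := by
    rw [← Nat.mul_add]; exact Nat.mul_le_mul_left ℓ h2
  have e : 2 * ℓ * J = ℓ * J + ℓ * J := by ring
  omega

end Deterministic

section PerLength

open scoped Classical

/-- Positions of the odd chunks stay inside the word. [folklore] -/
theorem oddChunk_pos_lt {n ℓ : ℕ} (t : Fin ((n - 1) / (ℓ + 1) / 2)) (q : Fin (ℓ + 1)) :
    1 + 2 * (t : ℕ) * (ℓ + 1) + (ℓ + 1) + q < n := by
  have h1 : (2 * (t : ℕ) + 2) * (ℓ + 1) ≤ (n - 1) / (ℓ + 1) * (ℓ + 1) :=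
    Nat.mul_le_mul_right _ (by omega)
  have h2 := Nat.div_mul_le_self (n - 1) (ℓ + 1)
  have e : (2 * (t : ℕ) + 2) * (ℓ + 1) = 2 * (t : ℕ) * (ℓ + 1) + (ℓ + 1) + (ℓ + 1) := by ring
  omega

/-- Positions of the even chunks `≥ 2` stay inside the word. [folklore] -/
theorem evenChunk_pos_lt {n ℓ : ℕ} (t : Fin (((n - 1) / (ℓ + 1) - 1) / 2)) (q : Fin (ℓ + 1)) :
    1 + (2 * (t : ℕ) + 1) * (ℓ + 1) + (ℓ + 1) + q < n := by
  have h1 : (2 * (t : ℕ) + 3) * (ℓ + 1) ≤ (n - 1) / (ℓ + 1) * (ℓ + 1) :=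
    Nat.mul_le_mul_right _ (by omega)
  have h2 := Nat.div_mul_le_self (n - 1) (ℓ + 1)
  have e : (2 * (t : ℕ) + 3) * (ℓ + 1) = (2 * (t : ℕ) + 1) * (ℓ + 1) + (ℓ + 1) + (ℓ + 1) := by ring
  omega

/-- Chunk indices: every `j < J` is `0`, odd `2t+1` with `t < J/2`, or even `2t+2` with
`t < (J−1)/2`; hence a count over chunks is at most `1 +` the count over odd chunks `+` the count
over even chunks `≥ 2`. [folklore] -/
theorem card_filter_chunks_le {J : ℕ} (P : Fin J → Prop) [DecidablePred P] :
    (Finset.univ.filter P).card ≤ 1 +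
      (Finset.univ.filter fun t : Fin (J / 2) => P ⟨2 * (t : ℕ) + 1, by omega⟩).card +
      (Finset.univ.filter fun t : Fin ((J - 1) / 2) => P ⟨2 * (t : ℕ) + 2, by omega⟩).card := by
  have hsub : Finset.univ.filter P ⊆
      (Finset.univ.filter fun j : Fin J => (j : ℕ) = 0) ∪
      ((Finset.univ.filter fun t : Fin (J / 2) => P ⟨2 * (t : ℕ) + 1, by omega⟩).image
        fun t : Fin (J / 2) => (⟨2 * (t : ℕ) + 1, by omega⟩ : Fin J)) ∪
      ((Finset.univ.filter fun t : Fin ((J - 1) / 2) => P ⟨2 * (t : ℕ) + 2, by omega⟩).image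
        fun t : Fin ((J - 1) / 2) => (⟨2 * (t : ℕ) + 2, by omega⟩ : Fin J)) := by
    intro j hj
    rw [Finset.mem_filter] at hj
    rw [Finset.mem_union, Finset.mem_union, Finset.mem_filter, Finset.mem_image, Finset.mem_image]
    have hjlt := j.isLt
    rcases Nat.even_or_odd (j : ℕ) with ⟨m, hm⟩ | ⟨m, hm⟩
    · rcases Nat.eq_zero_or_pos m with h0 | h0
      · exact Or.inl (Or.inl ⟨Finset.mem_univ _, by omega⟩)
      · right
        refine ⟨⟨m - 1, by omega⟩, Finset.mem_filter.mpr ⟨Finset.mem_univ _, ?_⟩, ?_⟩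
        · have e : (⟨2 * (m - 1) + 2, by omega⟩ : Fin J) = j := Fin.ext (by simp only; omega)
          rw [e]; exact hj.2
        · exact Fin.ext (by simp only; omega)
    · left; right
      refine ⟨⟨m, by omega⟩, Finset.mem_filter.mpr ⟨Finset.mem_univ _, ?_⟩, ?_⟩
      · have e : (⟨2 * m + 1, by omega⟩ : Fin J) = j := Fin.ext (by simp only; omega)
        rw [e]; exact hj.2
      · exact Fin.ext (by simp only; omega)
  refine (Finset.card_le_card hsub).trans ?_
  refine (Finset.card_union_le _ _).trans ?_
  refine Nat.add_le_add ((Finset.card_union_le _ _).trans (Nat.add_le_add ?_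
    Finset.card_image_le)) Finset.card_image_le
  rw [Finset.card_le_one]
  intro a ha b hb
  rw [Finset.mem_filter] at ha hb
  exact Fin.ext (by omega)

/-- **The bad words (chunk types off balance) are few.** For `k ≥ 2`, `n`, `ℓ` and `0 ≤ δ ≤ 2`:
the reduced words of length `n` for which some reduced type `σ` of length `ℓ+1` is over-represented
among the odd chunks (`≥ (1+δ) T₁ p`) or among the even chunks `≥ 2` (`≥ (1+δ) T₂ p`),
`p = (q^{ℓ+2} + 2k + 1)/(2k q^{2ℓ+2})`, number at most `2 |F_{ℓ+1}| |F_n| exp(−δ² T₂ p/4)`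
(`T₁ = ⌊J/2⌋ ≥ T₂ = ⌊(J−1)/2⌋`, `J = ⌊(n−1)/(ℓ+1)⌋`). [cite: CalegariWalker2013, Lemma 2.5] -/
theorem card_filter_badChunks_le (k n ℓ : ℕ) (hk : 2 ≤ k) {δ : ℝ} (hδ : 0 ≤ δ) (hδ2 : δ ≤ 2) :
    (((reducedWords k n).filter fun w => ¬ ∀ σ ∈ reducedWords k (ℓ + 1),
        (∑ t : Fin ((n - 1) / (ℓ + 1) / 2), if (∀ q : Fin (ℓ + 1),
            w ⟨1 + 2 * (t : ℕ) * (ℓ + 1) + (ℓ + 1) + q, oddChunk_pos_lt t q⟩ = σ q)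
            then (1 : ℝ) else 0) <
          (1 + δ) * (((n - 1) / (ℓ + 1) / 2 : ℕ) * (((2 * k - 1 : ℝ) ^ (ℓ + 2) + 2 * k + 1) /
            (2 * k * (2 * k - 1 : ℝ) ^ (ℓ + 1 + (ℓ + 1))))) ∧
        (∑ t : Fin (((n - 1) / (ℓ + 1) - 1) / 2), if (∀ q : Fin (ℓ + 1),
            w ⟨1 + (2 * (t : ℕ) + 1) * (ℓ + 1) + (ℓ + 1) + q, evenChunk_pos_lt t q⟩ = σ q)
            then (1 : ℝ) else 0) <
          (1 + δ) * ((((n - 1) / (ℓ + 1) - 1) / 2 : ℕ) * (((2 * k - 1 : ℝ) ^ (ℓ + 2) + 2 * k + 1) /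
            (2 * k * (2 * k - 1 : ℝ) ^ (ℓ + 1 + (ℓ + 1)))))).card : ℝ) ≤
      2 * (reducedWords k (ℓ + 1)).card * (reducedWords k n).card *
        Real.exp (-(δ ^ 2 * ((((n - 1) / (ℓ + 1) - 1) / 2 : ℕ) *
          (((2 * k - 1 : ℝ) ^ (ℓ + 2) + 2 * k + 1) /
            (2 * k * (2 * k - 1 : ℝ) ^ (ℓ + 1 + (ℓ + 1))))) / 4)) := by
  set J := (n - 1) / (ℓ + 1) with hJ
  set T₁ := J / 2 with hT₁
  set T₂ := (J - 1) / 2 with hT₂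
  set p : ℝ := ((2 * k - 1 : ℝ) ^ (ℓ + 2) + 2 * k + 1) /
    (2 * k * (2 * k - 1 : ℝ) ^ (ℓ + 1 + (ℓ + 1))) with hp
  have hJn : J * (ℓ + 1) ≤ n - 1 := Nat.div_mul_le_self _ _
  have hk1 : (1 : ℝ) ≤ 2 * k - 1 := by
    have : (2 : ℝ) ≤ k := by exact_mod_cast hk
    linarith
  have hppos : 0 ≤ p := by rw [hp]; positivity
  -- the events
  set A : (Fin (ℓ + 1) → Fin k × Bool) → Finset (Fin n → Fin k × Bool) := fun σ =>
    (reducedWords k n).filter fun w => (1 + δ) * (T₁ * p) ≤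
      ∑ t : Fin T₁, if (∀ q : Fin (ℓ + 1),
          w ⟨1 + 2 * (t : ℕ) * (ℓ + 1) + (ℓ + 1) + q, oddChunk_pos_lt t q⟩ = σ q)
          then (1 : ℝ) else 0 with hA
  set B : (Fin (ℓ + 1) → Fin k × Bool) → Finset (Fin n → Fin k × Bool) := fun σ =>
    (reducedWords k n).filter fun w => (1 + δ) * (T₂ * p) ≤
      ∑ t : Fin T₂, if (∀ q : Fin (ℓ + 1),
          w ⟨1 + (2 * (t : ℕ) + 1) * (ℓ + 1) + (ℓ + 1) + q, evenChunk_pos_lt t q⟩ = σ q)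
          then (1 : ℝ) else 0 with hB
  -- the two applications of Lemma 2.5
  have hodd : ∀ σ ∈ reducedWords k (ℓ + 1),
      ((A σ).card : ℝ) ≤ (reducedWords k n).card * Real.exp (-(δ ^ 2 * (T₁ * p) / 4)) := by
    intro σ hσ
    exact card_filter_windowCount_ge_le k n ℓ ℓ T₁ hk (fun t => 1 + 2 * t * (ℓ + 1))
      (by show 1 ≤ 1 + 2 * 0 * (ℓ + 1); omega)
      (by
        intro t u htu
        show 1 + 2 * t * (ℓ + 1) + (ℓ + 1 + (ℓ + 1)) ≤ 1 + 2 * u * (ℓ + 1)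
        have h1 := Nat.mul_le_mul_right (ℓ + 1) (show 2 * t + 2 ≤ 2 * u by omega)
        have e : (2 * t + 2) * (ℓ + 1) = 2 * t * (ℓ + 1) + (ℓ + 1) + (ℓ + 1) := by ring
        omega)
      (by
        intro t ht
        show 1 + 2 * t * (ℓ + 1) + (ℓ + 1 + (ℓ + 1)) ≤ n
        have h1 : (2 * t + 2) * (ℓ + 1) ≤ J * (ℓ + 1) := Nat.mul_le_mul_right _ (by omega)
        have e : (2 * t + 2) * (ℓ + 1) = 2 * t * (ℓ + 1) + (ℓ + 1) + (ℓ + 1) := by ring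
        omega)
      σ hσ hδ hδ2
  have heven : ∀ σ ∈ reducedWords k (ℓ + 1),
      ((B σ).card : ℝ) ≤ (reducedWords k n).card * Real.exp (-(δ ^ 2 * (T₂ * p) / 4)) := by
    intro σ hσ
    exact card_filter_windowCount_ge_le k n ℓ ℓ T₂ hk (fun t => 1 + (2 * t + 1) * (ℓ + 1))
      (by show 1 ≤ 1 + (2 * 0 + 1) * (ℓ + 1); omega)
      (by
        intro t u htu
        show 1 + (2 * t + 1) * (ℓ + 1) + (ℓ + 1 + (ℓ + 1)) ≤ 1 + (2 * u + 1) * (ℓ + 1)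
        have h1 := Nat.mul_le_mul_right (ℓ + 1) (show 2 * t + 3 ≤ 2 * u + 1 by omega)
        have e : (2 * t + 3) * (ℓ + 1) = (2 * t + 1) * (ℓ + 1) + (ℓ + 1) + (ℓ + 1) := by ring
        omega)
      (by
        intro t ht
        show 1 + (2 * t + 1) * (ℓ + 1) + (ℓ + 1 + (ℓ + 1)) ≤ n
        have h1 : (2 * t + 3) * (ℓ + 1) ≤ J * (ℓ + 1) := Nat.mul_le_mul_right _ (by omega)
        have e : (2 * t + 3) * (ℓ + 1) = (2 * t + 1) * (ℓ + 1) + (ℓ + 1) + (ℓ + 1) := by ring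
        omega)
      σ hσ hδ hδ2
  -- `exp(-δ² T₁ p/4) ≤ exp(-δ² T₂ p/4)`
  have hT : (T₂ : ℝ) ≤ T₁ := by
    exact_mod_cast (show T₂ ≤ T₁ from Nat.div_le_div_right (Nat.sub_le J 1))
  have hexp : Real.exp (-(δ ^ 2 * (T₁ * p) / 4)) ≤ Real.exp (-(δ ^ 2 * (T₂ * p) / 4)) := by
    rw [Real.exp_le_exp]
    have : δ ^ 2 * (T₂ * p) ≤ δ ^ 2 * (T₁ * p) :=
      mul_le_mul_of_nonneg_left (mul_le_mul_of_nonneg_right hT hppos) (sq_nonneg δ)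
    linarith
  -- union bound
  have hsub : ((reducedWords k n).filter fun w => ¬ ∀ σ ∈ reducedWords k (ℓ + 1),
      (∑ t : Fin T₁, if (∀ q : Fin (ℓ + 1),
          w ⟨1 + 2 * (t : ℕ) * (ℓ + 1) + (ℓ + 1) + q, oddChunk_pos_lt t q⟩ = σ q)
          then (1 : ℝ) else 0) < (1 + δ) * (T₁ * p) ∧
      (∑ t : Fin T₂, if (∀ q : Fin (ℓ + 1),
          w ⟨1 + (2 * (t : ℕ) + 1) * (ℓ + 1) + (ℓ + 1) + q, evenChunk_pos_lt t q⟩ = σ q)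
          then (1 : ℝ) else 0) < (1 + δ) * (T₂ * p)) ⊆
      (reducedWords k (ℓ + 1)).biUnion fun σ => A σ ∪ B σ := by
    intro w hw
    rw [Finset.mem_filter] at hw
    obtain ⟨hwred, hbad⟩ := hw
    rw [Finset.mem_biUnion]
    by_contra hcon
    apply hbad
    intro σ hσ
    by_contra hgood
    rw [not_and_or, not_lt, not_lt] at hgood
    apply hcon
    refine ⟨σ, hσ, ?_⟩
    rw [Finset.mem_union]
    rcases hgood with h | h
    · exact Or.inl (Finset.mem_filter.mpr ⟨hwred, h⟩)
    · exact Or.inr (Finset.mem_filter.mpr ⟨hwred, h⟩)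
  have hcard := (Finset.card_le_card hsub).trans Finset.card_biUnion_le
  have hcard' := (Nat.cast_le (α := ℝ)).mpr hcard
  rw [Nat.cast_sum] at hcard'
  refine hcard'.trans ?_
  calc ∑ σ ∈ reducedWords k (ℓ + 1), (((A σ ∪ B σ).card : ℕ) : ℝ)
      ≤ ∑ σ ∈ reducedWords k (ℓ + 1), (((A σ).card : ℝ) + ((B σ).card : ℝ)) :=
        Finset.sum_le_sum fun σ _ => by exact_mod_cast Finset.card_union_le _ _
    _ ≤ ∑ _σ ∈ reducedWords k (ℓ + 1), 2 * ((reducedWords k n).card *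
          Real.exp (-(δ ^ 2 * (T₂ * p) / 4))) :=
        Finset.sum_le_sum fun σ hσ => by
          have h1 := (hodd σ hσ).trans (mul_le_mul_of_nonneg_left hexp (Nat.cast_nonneg _))
          have h2 := heven σ hσ
          linarith
    _ = 2 * (reducedWords k (ℓ + 1)).card * (reducedWords k n).card *
          Real.exp (-(δ ^ 2 * (T₂ * p) / 4)) := by
        rw [Finset.sum_const, nsmul_eq_mul]; ring

/-- **Good words have small cl.** If for every reduced type `σ` of length `ℓ + 1` the odd and
even chunk counts are below `(1+δ) T₁ p` and `(1+δ) T₂ p`, then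
`4 cl(w) ≤ n + 2 + ℓ |F_{ℓ+1}| (1 + (1+δ) J p) − 2 ℓ J`. [cite: CalegariWalker2013, §4.3 (weak form)] -/
theorem four_mul_cl_le_of_good (k n ℓ : ℕ) {δ : ℝ} (hδ : 0 ≤ δ) {w : Fin n → Fin k × Bool}
    (hw : w ∈ commutatorWords k n)
    (hgood : ∀ σ ∈ reducedWords k (ℓ + 1),
        (∑ t : Fin ((n - 1) / (ℓ + 1) / 2), if (∀ q : Fin (ℓ + 1),
            w ⟨1 + 2 * (t : ℕ) * (ℓ + 1) + (ℓ + 1) + q, oddChunk_pos_lt t q⟩ = σ q)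
            then (1 : ℝ) else 0) <
          (1 + δ) * (((n - 1) / (ℓ + 1) / 2 : ℕ) * (((2 * k - 1 : ℝ) ^ (ℓ + 2) + 2 * k + 1) /
            (2 * k * (2 * k - 1 : ℝ) ^ (ℓ + 1 + (ℓ + 1))))) ∧
        (∑ t : Fin (((n - 1) / (ℓ + 1) - 1) / 2), if (∀ q : Fin (ℓ + 1),
            w ⟨1 + (2 * (t : ℕ) + 1) * (ℓ + 1) + (ℓ + 1) + q, evenChunk_pos_lt t q⟩ = σ q)
            then (1 : ℝ) else 0) <
          (1 + δ) * ((((n - 1) / (ℓ + 1) - 1) / 2 : ℕ) * (((2 * k - 1 : ℝ) ^ (ℓ + 2) + 2 * k + 1) /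
            (2 * k * (2 * k - 1 : ℝ) ^ (ℓ + 1 + (ℓ + 1)))))) :
    4 * (commutatorLength (FreeGroup.mk (List.ofFn w)) : ℝ) ≤
      n + 2 + ℓ * ((reducedWords k (ℓ + 1)).card : ℝ) * (1 + (1 + δ) * (((n - 1) / (ℓ + 1) : ℕ) *
        (((2 * k - 1 : ℝ) ^ (ℓ + 2) + 2 * k + 1) / (2 * k * (2 * k - 1 : ℝ) ^ (ℓ + 1 + (ℓ + 1)))))) -
      2 * ℓ * ((n - 1) / (ℓ + 1) : ℕ) := by
  set J := (n - 1) / (ℓ + 1) with hJ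
  set T₁ := J / 2 with hT₁
  set T₂ := (J - 1) / 2 with hT₂
  set p : ℝ := ((2 * k - 1 : ℝ) ^ (ℓ + 2) + 2 * k + 1) /
    (2 * k * (2 * k - 1 : ℝ) ^ (ℓ + 1 + (ℓ + 1))) with hp
  have hppos : 0 ≤ p := by
    rw [hp]
    rcases Nat.eq_zero_or_pos k with hk0 | hk0
    · subst hk0; simp
    · have hk1 : (1 : ℝ) ≤ 2 * k - 1 := by
        have : (1 : ℝ) ≤ k := by exact_mod_cast hk0
        linarith
      positivity
  -- the type of chunk `j`
  set typ : Fin J → (Fin (ℓ + 1) → Fin k × Bool) := fun j q =>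
    w ⟨1 + (j : ℕ) * (ℓ + 1) + q, by have := chunk_bound j; omega⟩ with htyp
  -- odd and even chunk types in the form of Lemma 2.5
  have hoddE : ∀ (σ : Fin (ℓ + 1) → Fin k × Bool) (t : Fin T₁),
      (∀ q : Fin (ℓ + 1), w ⟨1 + 2 * (t : ℕ) * (ℓ + 1) + (ℓ + 1) + q, oddChunk_pos_lt t q⟩ = σ q) ↔
        typ ⟨2 * (t : ℕ) + 1, by omega⟩ = σ := by
    intro σ t
    have e : ∀ q : Fin (ℓ + 1), (⟨1 + 2 * (t : ℕ) * (ℓ + 1) + (ℓ + 1) + q, oddChunk_pos_lt t q⟩ :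
        Fin n) = ⟨1 + (2 * (t : ℕ) + 1) * (ℓ + 1) + q, by
          have := chunk_bound (n := n) (ℓ := ℓ) ⟨2 * t + 1, by omega⟩; exact this |> fun h => by
            have e2 : (2 * (t : ℕ) + 1) * (ℓ + 1) = 2 * (t : ℕ) * (ℓ + 1) + (ℓ + 1) := by ring
            have := oddChunk_pos_lt t q; omega⟩ := by
      intro q
      apply Fin.ext
      show 1 + 2 * (t : ℕ) * (ℓ + 1) + (ℓ + 1) + q = 1 + (2 * (t : ℕ) + 1) * (ℓ + 1) + q
      ring
    constructor
    · intro h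
      funext q
      show w ⟨1 + (2 * (t : ℕ) + 1) * (ℓ + 1) + q, _⟩ = σ q
      rw [← h q]
      exact congrArg w (e q).symm
    · intro h q
      rw [e q]
      exact congrFun h q
  have hevenE : ∀ (σ : Fin (ℓ + 1) → Fin k × Bool) (t : Fin T₂),
      (∀ q : Fin (ℓ + 1), w ⟨1 + (2 * (t : ℕ) + 1) * (ℓ + 1) + (ℓ + 1) + q, evenChunk_pos_lt t q⟩ =
        σ q) ↔ typ ⟨2 * (t : ℕ) + 2, by omega⟩ = σ := by
    intro σ t
    have e : ∀ q : Fin (ℓ + 1), (⟨1 + (2 * (t : ℕ) + 1) * (ℓ + 1) + (ℓ + 1) + q,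
        evenChunk_pos_lt t q⟩ : Fin n) = ⟨1 + (2 * (t : ℕ) + 2) * (ℓ + 1) + q, by
          have e2 : (2 * (t : ℕ) + 2) * (ℓ + 1) = (2 * (t : ℕ) + 1) * (ℓ + 1) + (ℓ + 1) := by ring
          have := evenChunk_pos_lt t q; omega⟩ := by
      intro q
      apply Fin.ext
      show 1 + (2 * (t : ℕ) + 1) * (ℓ + 1) + (ℓ + 1) + q = 1 + (2 * (t : ℕ) + 2) * (ℓ + 1) + q
      ring
    constructor
    · intro h
      funext q
      show w ⟨1 + (2 * (t : ℕ) + 2) * (ℓ + 1) + q, _⟩ = σ q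
      rw [← h q]
      exact congrArg w (e q).symm
    · intro h q
      rw [e q]
      exact congrFun h q
  -- every type count is `≤ U`
  set U : ℕ := ⌊1 + (1 + δ) * (J * p)⌋₊ with hU
  have hTJ : (T₁ : ℝ) + T₂ ≤ J := by
    have key : ∀ m : ℕ, m / 2 + (m - 1) / 2 ≤ m := fun m => by omega
    exact_mod_cast key J
  have hcount : ∀ σ ∈ reducedWords k (ℓ + 1),
      (Finset.univ.filter fun j : Fin J => typ j = σ).card ≤ U := by
    intro σ hσ
    obtain ⟨h1, h2⟩ := hgood σ hσ
    have hc := card_filter_chunks_le (fun j : Fin J => typ j = σ)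
    -- odd count
    have ho : ((Finset.univ.filter fun t : Fin T₁ => typ ⟨2 * (t : ℕ) + 1, by omega⟩ = σ).card : ℝ) <
        (1 + δ) * (T₁ * p) := by
      have e : ((Finset.univ.filter fun t : Fin T₁ => typ ⟨2 * (t : ℕ) + 1, by omega⟩ = σ).card : ℝ) =
          ∑ t : Fin T₁, if (∀ q : Fin (ℓ + 1),
            w ⟨1 + 2 * (t : ℕ) * (ℓ + 1) + (ℓ + 1) + q, oddChunk_pos_lt t q⟩ = σ q)
            then (1 : ℝ) else 0 := by
        rw [Finset.sum_boole]
        congr 2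
        exact Finset.filter_congr fun t _ => (hoddE σ t).symm
      rw [e]; exact h1
    have he : ((Finset.univ.filter fun t : Fin T₂ => typ ⟨2 * (t : ℕ) + 2, by omega⟩ = σ).card : ℝ) <
        (1 + δ) * (T₂ * p) := by
      have e : ((Finset.univ.filter fun t : Fin T₂ => typ ⟨2 * (t : ℕ) + 2, by omega⟩ = σ).card : ℝ) =
          ∑ t : Fin T₂, if (∀ q : Fin (ℓ + 1),
            w ⟨1 + (2 * (t : ℕ) + 1) * (ℓ + 1) + (ℓ + 1) + q, evenChunk_pos_lt t q⟩ = σ q)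
            then (1 : ℝ) else 0 := by
        rw [Finset.sum_boole]
        congr 2
        exact Finset.filter_congr fun t _ => (hevenE σ t).symm
      rw [e]; exact h2
    have hcR : ((Finset.univ.filter fun j : Fin J => typ j = σ).card : ℝ) ≤
        1 + ((Finset.univ.filter fun t : Fin T₁ => typ ⟨2 * (t : ℕ) + 1, by omega⟩ = σ).card : ℝ) +
          ((Finset.univ.filter fun t : Fin T₂ => typ ⟨2 * (t : ℕ) + 2, by omega⟩ = σ).card : ℝ) := by
      have h := (Nat.cast_le (α := ℝ)).mpr hc
      push_cast at h
      exact h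
    apply Nat.le_floor
    have hδ1 : 0 ≤ 1 + δ := by linarith
    nlinarith [mul_nonneg hδ1 hppos]
  have hmain := four_mul_cl_le_of_goodChunks k n ℓ hw U hcount
  have hUle : (U : ℝ) ≤ 1 + (1 + δ) * (J * p) := by
    apply Nat.floor_le
    have : 0 ≤ (1 + δ) * (J * p) := by positivity
    linarith
  have hmainR : (4 * (commutatorLength (FreeGroup.mk (List.ofFn w)) : ℝ)) + 2 * ℓ * (J : ℝ) ≤
      n + 2 + ℓ * (((reducedWords k (ℓ + 1)).card : ℝ) * U) := by
    exact_mod_cast hmain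
  have hℓ0 : (0 : ℝ) ≤ ℓ * ((reducedWords k (ℓ + 1)).card : ℝ) := by positivity
  have := mul_le_mul_of_nonneg_left hUle hℓ0
  nlinarith

/-- **Per-length upper-tail bound, before asymptotics.** For `k ≥ 2` and eventually all even `n`:
for every `ℓ` and `0 ≤ δ ≤ 2`, the words of `F_n'` with
`scl > (n + 2 + ℓ |F_{ℓ+1}| (1 + (1+δ) J p) − 2 ℓ J)/4` number at most
`4 (n+1)^k |F_{ℓ+1}| exp(−δ² T₂ p / 4) |F_n'|`. [cite: CalegariWalker2013, Thm 4.1 (weak upper bound)] -/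
theorem card_filter_scl_gt_le (k : ℕ) (hk : 2 ≤ k) :
    ∀ᶠ n : ℕ in atTop, Even n → ∀ ℓ : ℕ, ∀ δ : ℝ, 0 ≤ δ → δ ≤ 2 →
      ((((commutatorWords k n).filter fun w =>
          (n + 2 + ℓ * ((reducedWords k (ℓ + 1)).card : ℝ) * (1 + (1 + δ) *
            (((n - 1) / (ℓ + 1) : ℕ) * (((2 * k - 1 : ℝ) ^ (ℓ + 2) + 2 * k + 1) /
              (2 * k * (2 * k - 1 : ℝ) ^ (ℓ + 1 + (ℓ + 1)))))) -
            2 * ℓ * ((n - 1) / (ℓ + 1) : ℕ)) / 4 <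
          stableCommutatorLength (FreeGroup.mk (List.ofFn w))).card : ℕ) : ℝ) ≤
        4 * ((n : ℝ) + 1) ^ k * (reducedWords k (ℓ + 1)).card *
          Real.exp (-(δ ^ 2 * ((((n - 1) / (ℓ + 1) - 1) / 2 : ℕ) *
            (((2 * k - 1 : ℝ) ^ (ℓ + 2) + 2 * k + 1) /
              (2 * k * (2 * k - 1 : ℝ) ^ (ℓ + 1 + (ℓ + 1))))) / 4)) *
          ((commutatorWords k n).card : ℝ) := by
  filter_upwards [transfer_to_commutatorWords k hk, Filter.eventually_ge_atTop 1] with n htr hn1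
    heven ℓ δ hδ hδ2
  -- the bad set (opaque)
  set bad : (Fin n → Fin k × Bool) → Prop := fun w => ¬ ∀ σ ∈ reducedWords k (ℓ + 1),
      (∑ t : Fin ((n - 1) / (ℓ + 1) / 2), if (∀ q : Fin (ℓ + 1),
          w ⟨1 + 2 * (t : ℕ) * (ℓ + 1) + (ℓ + 1) + q, oddChunk_pos_lt t q⟩ = σ q)
          then (1 : ℝ) else 0) <
        (1 + δ) * (((n - 1) / (ℓ + 1) / 2 : ℕ) * (((2 * k - 1 : ℝ) ^ (ℓ + 2) + 2 * k + 1) /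
          (2 * k * (2 * k - 1 : ℝ) ^ (ℓ + 1 + (ℓ + 1))))) ∧
      (∑ t : Fin (((n - 1) / (ℓ + 1) - 1) / 2), if (∀ q : Fin (ℓ + 1),
          w ⟨1 + (2 * (t : ℕ) + 1) * (ℓ + 1) + (ℓ + 1) + q, evenChunk_pos_lt t q⟩ = σ q)
          then (1 : ℝ) else 0) <
        (1 + δ) * ((((n - 1) / (ℓ + 1) - 1) / 2 : ℕ) * (((2 * k - 1 : ℝ) ^ (ℓ + 2) + 2 * k + 1) /
          (2 * k * (2 * k - 1 : ℝ) ^ (ℓ + 1 + (ℓ + 1))))) with hbad_def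
  clear_value bad
  -- words with large scl are bad
  have hsub : ((commutatorWords k n).filter fun w =>
      (n + 2 + ℓ * ((reducedWords k (ℓ + 1)).card : ℝ) * (1 + (1 + δ) *
        (((n - 1) / (ℓ + 1) : ℕ) * (((2 * k - 1 : ℝ) ^ (ℓ + 2) + 2 * k + 1) /
          (2 * k * (2 * k - 1 : ℝ) ^ (ℓ + 1 + (ℓ + 1)))))) -
        2 * ℓ * ((n - 1) / (ℓ + 1) : ℕ)) / 4 <
      stableCommutatorLength (FreeGroup.mk (List.ofFn w))) ⊆
      (commutatorWords k n).filter fun w => bad w := by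
    intro w hw
    rw [Finset.mem_filter] at hw ⊢
    refine ⟨hw.1, ?_⟩
    rw [hbad_def]
    intro hgood
    have h4 := four_mul_cl_le_of_good k n ℓ hδ hw.1 hgood
    have hscl := stableCommutatorLength_le_commutatorLength (FreeGroup.mk (List.ofFn w))
    linarith [hw.2]
  have h1 : ((((commutatorWords k n).filter fun w =>
      (n + 2 + ℓ * ((reducedWords k (ℓ + 1)).card : ℝ) * (1 + (1 + δ) *
        (((n - 1) / (ℓ + 1) : ℕ) * (((2 * k - 1 : ℝ) ^ (ℓ + 2) + 2 * k + 1) /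
          (2 * k * (2 * k - 1 : ℝ) ^ (ℓ + 1 + (ℓ + 1)))))) -
        2 * ℓ * ((n - 1) / (ℓ + 1) : ℕ)) / 4 <
      stableCommutatorLength (FreeGroup.mk (List.ofFn w))).card : ℕ) : ℝ) ≤
      (((commutatorWords k n).filter fun w => bad w).card : ℝ) :=
    (Nat.cast_le (α := ℝ)).mpr (Finset.card_le_card hsub)
  -- transfer and the bound on reduced words
  have htr' := htr heven bad
  have hbad : (((reducedWords k n).filter fun w => bad w).card : ℝ) ≤
      2 * (reducedWords k (ℓ + 1)).card * (reducedWords k n).card *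
        Real.exp (-(δ ^ 2 * ((((n - 1) / (ℓ + 1) - 1) / 2 : ℕ) *
          (((2 * k - 1 : ℝ) ^ (ℓ + 2) + 2 * k + 1) /
            (2 * k * (2 * k - 1 : ℝ) ^ (ℓ + 1 + (ℓ + 1))))) / 4)) := by
    have h := card_filter_badChunks_le k n ℓ hk hδ hδ2
    subst hbad_def
    convert h using 4
  -- `|F_n| > 0`
  have hFpos : (0 : ℝ) < (reducedWords k n).card := by
    have h := card_reducedWords k hn1
    have : 0 < (reducedWords k n).card := by
      rw [h]
      exact Nat.mul_pos (by omega) (Nat.pow_pos (by omega))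
    exact_mod_cast this
  refine h1.trans ?_
  refine le_of_mul_le_mul_right ?_ hFpos
  refine htr'.trans ?_
  have hpos : (0 : ℝ) ≤ 2 * ((n : ℝ) + 1) ^ k := by positivity
  have hC : (0 : ℝ) ≤ ((commutatorWords k n).card : ℝ) := Nat.cast_nonneg _
  calc 2 * ((n : ℝ) + 1) ^ k * (((reducedWords k n).filter fun w => bad w).card : ℝ) *
        ((commutatorWords k n).card : ℝ)
      ≤ 2 * ((n : ℝ) + 1) ^ k * (2 * (reducedWords k (ℓ + 1)).card * (reducedWords k n).card *
          Real.exp (-(δ ^ 2 * ((((n - 1) / (ℓ + 1) - 1) / 2 : ℕ) *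
            (((2 * k - 1 : ℝ) ^ (ℓ + 2) + 2 * k + 1) /
              (2 * k * (2 * k - 1 : ℝ) ^ (ℓ + 1 + (ℓ + 1))))) / 4))) *
          ((commutatorWords k n).card : ℝ) := by
        apply mul_le_mul_of_nonneg_right _ hC
        exact mul_le_mul_of_nonneg_left hbad hpos
    _ = _ := by ring

end PerLength

section Asymptotics

/-- **The window-length parameter, `L ≤ 1`.** For `q ≥ 3` and `1/2 ≤ L ≤ 1`, with
`ℓ(n) = ⌊L log n / log q⌋`: eventually `1 ≤ ℓ`, `ℓ ≤ L log n / log q`, `ℓ + 1 ≤ 3 log n`,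
`1 ≤ log n`, `n^L ≤ q^{ℓ + 1}` and `q^ℓ ≤ n^L`. [folklore] -/
theorem eventually_windowLength' {q L : ℝ} (hq : 3 ≤ q) (hL1 : 1 / 2 ≤ L) (hL2 : L ≤ 1) :
    ∀ᶠ n : ℕ in atTop, 1 ≤ ⌊L * Real.log n / Real.log q⌋₊ ∧
      (⌊L * Real.log n / Real.log q⌋₊ : ℝ) ≤ L * Real.log n / Real.log q ∧
      (⌊L * Real.log n / Real.log q⌋₊ : ℝ) + 1 ≤ 3 * Real.log n ∧
      1 ≤ Real.log n ∧
      (n : ℝ) ^ L ≤ q ^ (⌊L * Real.log n / Real.log q⌋₊ + 1) ∧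
      q ^ ⌊L * Real.log n / Real.log q⌋₊ ≤ (n : ℝ) ^ L := by
  have hlq : 1 < Real.log q := one_lt_log_three.trans_le (Real.log_le_log (by norm_num) hq)
  have hlq0 : 0 < Real.log q := by linarith
  have hqpos : 0 < q := by linarith
  have hlog : Tendsto (fun n : ℕ => Real.log n) atTop atTop :=
    Real.tendsto_log_atTop.comp tendsto_natCast_atTop_atTop
  filter_upwards [hlog.eventually_ge_atTop (2 * Real.log q), hlog.eventually_ge_atTop 1,
    Filter.eventually_ge_atTop 1] with n hnq hn1 hnpos
  have hnR : (0 : ℝ) < n := by exact_mod_cast (show 0 < n by omega)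
  set x := L * Real.log n / Real.log q with hx
  have hx1 : 1 ≤ x := by
    rw [hx, le_div_iff₀ hlq0]
    nlinarith
  have hx0 : 0 ≤ x := by linarith
  have hfloor_le : (⌊x⌋₊ : ℝ) ≤ x := Nat.floor_le hx0
  have hlt : x < (⌊x⌋₊ : ℝ) + 1 := Nat.lt_floor_add_one x
  refine ⟨Nat.le_floor (by exact_mod_cast hx1), hfloor_le, ?_, hn1, ?_, ?_⟩
  · have hx2 : x ≤ 2 * Real.log n := by
      rw [hx, div_le_iff₀ hlq0]
      have h0 : 0 ≤ Real.log n := by linarith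
      nlinarith
    linarith
  · rw [Real.rpow_def_of_pos hnR, ← Real.rpow_natCast, Real.rpow_def_of_pos hqpos,
      Real.exp_le_exp]
    push_cast
    have : Real.log n * L = x * Real.log q := by
      rw [hx]; field_simp
    rw [this, mul_comm x]
    exact mul_le_mul_of_nonneg_left hlt.le hlq0.le
  · rw [Real.rpow_def_of_pos hnR, ← Real.rpow_natCast, Real.rpow_def_of_pos hqpos,
      Real.exp_le_exp]
    have : Real.log n * L = x * Real.log q := by
      rw [hx]; field_simp
    rw [this, mul_comm (Real.log q)]
    exact mul_le_mul_of_nonneg_right hfloor_le hlq0.le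

/-- Lower bound for a natural division: `a / b − 1 ≤ ⌊a / b⌋`. [folklore] -/
theorem natDiv_ge (a b : ℕ) (hb : 0 < b) : (a : ℝ) / b - 1 ≤ ((a / b : ℕ) : ℝ) := by
  have h := Nat.div_add_mod a b
  have hm := Nat.mod_lt a hb
  have hbR : (0 : ℝ) < b := by exact_mod_cast hb
  rw [sub_le_iff_le_add, div_le_iff₀ hbR]
  have h' : (a : ℝ) = b * ((a / b : ℕ) : ℝ) + ((a % b : ℕ) : ℝ) := by exact_mod_cast h.symm
  have hm' : ((a % b : ℕ) : ℝ) ≤ b := by exact_mod_cast hm.le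
  nlinarith

/-- The key identity `|F_{ℓ+1}| · p = 1 + (2k+1)/q^{ℓ+2}`. [folklore] -/
theorem card_types_mul_p (k ℓ : ℕ) (hk : 1 ≤ k) :
    ((reducedWords k (ℓ + 1)).card : ℝ) * (((2 * k - 1 : ℝ) ^ (ℓ + 2) + 2 * k + 1) /
        (2 * k * (2 * k - 1 : ℝ) ^ (ℓ + 1 + (ℓ + 1)))) =
      1 + (2 * k + 1) / (2 * k - 1 : ℝ) ^ (ℓ + 2) := by
  rw [card_reducedWords k (by omega : 1 ≤ ℓ + 1)]
  have hk1 : (1 : ℝ) ≤ 2 * k - 1 := by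
    have : (1 : ℝ) ≤ k := by exact_mod_cast hk
    linarith
  have hq0 : (2 * k - 1 : ℝ) ≠ 0 := by linarith
  have hk0 : (k : ℝ) ≠ 0 := by
    have : (1 : ℝ) ≤ k := by exact_mod_cast hk
    linarith
  push_cast [Nat.cast_sub (show 1 ≤ 2 * k by omega)]
  have e1 : (2 * k - 1 : ℝ) ^ (ℓ + 1 + (ℓ + 1)) = (2 * k - 1 : ℝ) ^ ℓ * (2 * k - 1 : ℝ) ^ (ℓ + 2) := by
    rw [← pow_add]; congr 1; omega
  simp only [e1]
  field_simp
  ring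

/-- **The per-length bound, simplified.** (Pure algebra.) [folklore] -/
theorem perLength_bound_le {n ℓ Jr T pp δ r₀ : ℝ} (hδ : 0 ≤ δ) (hr : 0 ≤ r₀)
    (hsmall : δ + 2 * r₀ ≤ 1) (hℓ : 0 ≤ ℓ) (hℓn : ℓ + 1 ≤ n) (hJ0 : 0 ≤ Jr)
    (hJ1 : n - 1 - ℓ ≤ Jr * (ℓ + 1)) (hJ2 : Jr ≤ (n - 1) / (ℓ + 1))
    (hTp : T * pp = 1 + r₀) :
    n + 2 + ℓ * T * (1 + (1 + δ) * (Jr * pp)) - 2 * ℓ * Jr ≤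
      (n - 1) / (ℓ + 1) + n * (δ + 2 * r₀) + ℓ * T + ℓ + 3 := by
  have e1 : ℓ * T * (1 + (1 + δ) * (Jr * pp)) = ℓ * T + ℓ * (1 + δ) * Jr * (T * pp) := by ring
  rw [e1, hTp]
  set s₀ := 1 - δ - r₀ - δ * r₀ with hs₀
  have hs0 : 0 ≤ s₀ := by rw [hs₀]; nlinarith
  have hs1 : s₀ ≤ 1 := by rw [hs₀]; nlinarith
  have e2 : ℓ * T + ℓ * (1 + δ) * Jr * (1 + r₀) - 2 * ℓ * Jr = ℓ * T - ℓ * Jr * s₀ := by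
    rw [hs₀]; ring
  have h1 : -(ℓ * Jr * s₀) ≤ -((n - 1 - ℓ - Jr) * s₀) := by
    have : (n - 1 - ℓ - Jr) ≤ ℓ * Jr := by nlinarith
    nlinarith
  have h2 : -((n - 1 - ℓ - Jr) * s₀) ≤ -((n - 1 - ℓ) * s₀) + Jr := by nlinarith
  have h3 : -((n - 1 - ℓ) * s₀) ≤ n * (δ + 2 * r₀) - n + 1 + ℓ := by
    have hn0 : 0 ≤ n - 1 - ℓ := by linarith
    have : (n - 1 - ℓ) * (1 - s₀) ≤ n * (δ + 2 * r₀) := by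
      have h1s : 1 - s₀ ≤ δ + 2 * r₀ := by rw [hs₀]; nlinarith
      calc (n - 1 - ℓ) * (1 - s₀) ≤ n * (1 - s₀) := by nlinarith
        _ ≤ n * (δ + 2 * r₀) := by nlinarith
    nlinarith
  nlinarith

/-- **Main term of the threshold.** If `ℓ + 1 > L' log n / log q` with `L' = 1 − θ`,
`0 < θ ≤ 1/4`, `θ log q ≤ ε`, then `n/(4(ℓ+1)) ≤ (log q/4 + ε/2) · n / log n`. [folklore] -/
theorem threshold_main_le {n ℓ lq θ ε : ℝ} (hn : 0 ≤ n) (hlog : 0 < Real.log n) (hlq : 0 < lq)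
    (hθ : 0 < θ) (hθ4 : θ ≤ 1 / 4) (hθε : θ * lq ≤ ε) (hℓ : 0 ≤ ℓ)
    (hlt : (1 - θ) * Real.log n / lq < ℓ + 1) :
    n / (4 * (ℓ + 1)) ≤ (lq / 4 + ε / 2) * n / Real.log n := by
  have hℓ1 : 0 < ℓ + 1 := by linarith
  -- `1/(ℓ+1) ≤ lq/((1-θ) log n)`
  have h1 : n / (4 * (ℓ + 1)) ≤ n * lq / (4 * (1 - θ) * Real.log n) := by
    rw [div_le_div_iff₀ (by positivity) (by nlinarith)]
    have : (1 - θ) * Real.log n ≤ (ℓ + 1) * lq := by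
      rw [div_lt_iff₀ hlq] at hlt; linarith
    nlinarith
  -- `lq/(4(1-θ)) ≤ lq/4 + ε/2`
  have h2 : n * lq / (4 * (1 - θ) * Real.log n) ≤ (lq / 4 + ε / 2) * n / Real.log n := by
    rw [div_le_div_iff₀ (by nlinarith) hlog]
    have hε : 0 < ε := lt_of_lt_of_le (mul_pos hθ hlq) hθε
    have h' : ε * θ ≤ ε * (1 / 4) := mul_le_mul_of_nonneg_left hθ4 hε.le
    have hkey : lq ≤ (lq / 4 + ε / 2) * (4 * (1 - θ)) := by nlinarith
    have h0 : 0 ≤ n * Real.log n := by positivity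
    calc n * lq * Real.log n = lq * (n * Real.log n) := by ring
      _ ≤ (lq / 4 + ε / 2) * (4 * (1 - θ)) * (n * Real.log n) :=
          mul_le_mul_of_nonneg_right hkey h0
      _ = (lq / 4 + ε / 2) * n * (4 * (1 - θ) * Real.log n) := by ring
  linarith

/-- **The error terms are `o(n / log n)`.** With `δ = n^{−θ/4}`, `r₀ ≤ (2k+1) n^{−(1−θ)}/q`,
`ℓ + 1 ≤ 3 log n`, `|𝒯| ≤ 2k n^{1−θ}`, and three smallness conditions, the error
`n(δ + 2r₀)/4 + (ℓ|𝒯| + ℓ + 3)/4 ≤ (ε/2) n / log n`. [folklore] -/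
theorem error_terms_le {n : ℕ} {k ℓ T r₀ θ ε q : ℝ} (hk : 1 ≤ k) (hq : 3 ≤ q) (hθ : 0 < θ)
    (hθ4 : θ ≤ 1 / 4) (hε : 0 < ε) (hlog : 1 ≤ Real.log n)
    (hℓ3 : ℓ + 1 ≤ 3 * Real.log n) (hT0 : 0 ≤ T) (hT : T ≤ 2 * k * (n : ℝ) ^ (1 - θ))
    (hr : r₀ ≤ (2 * k + 1) * (n : ℝ) ^ (-(1 - θ)) / q)
    (hs1 : (n : ℝ) ^ (-(θ / 8)) ≤ ε * θ / 16)
    (hs2 : (n : ℝ) ^ (-(1 / 4 : ℝ)) ≤ ε * q / (16 * (2 * k + 1)))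
    (hs3 : (n : ℝ) ^ (-(θ / 2)) ≤ ε * θ ^ 2 / (192 * k)) :
    (n : ℝ) * ((n : ℝ) ^ (-(θ / 4)) + 2 * r₀) / 4 + (ℓ * T + ℓ + 3) / 4 ≤
      ε / 2 * n / Real.log n := by
  have hn1 : (1 : ℝ) < n := by
    by_contra h
    rw [not_lt] at h
    have := Real.log_nonpos (Nat.cast_nonneg n) h
    linarith
  have hnR : (0 : ℝ) < n := by linarith
  have hlogpos : 0 < Real.log n := by linarith
  have hqpos : 0 < q := by linarith
  -- `log n ≤ n^η / η`
  have hl8 : Real.log n ≤ (n : ℝ) ^ (θ / 8) / (θ / 8) := Real.log_le_rpow_div hnR.le (by positivity)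
  have hl4 : Real.log n ≤ (n : ℝ) ^ (θ / 4) / (θ / 4) := Real.log_le_rpow_div hnR.le (by positivity)
  have hl2 : Real.log n ≤ (n : ℝ) ^ (1 / 2 : ℝ) / (1 / 2) := Real.log_le_rpow_div hnR.le (by norm_num)
  rw [← add_div, div_le_div_iff₀ (by norm_num : (0 : ℝ) < 4) hlogpos]
  -- (a) `n δ log n ≤ (ε/2) n`  (times 1/... bookkeeping: we prove `4 (LHS pieces) log n ≤ 2 ε n`)
  have hA : (n : ℝ) * (n : ℝ) ^ (-(θ / 4)) * Real.log n ≤ ε / 2 * n := by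
    have h1 : (n : ℝ) ^ (-(θ / 4)) * Real.log n ≤ (n : ℝ) ^ (-(θ / 8)) * (8 / θ) := by
      have e : (n : ℝ) ^ (-(θ / 4)) * (n : ℝ) ^ (θ / 8) = (n : ℝ) ^ (-(θ / 8)) := by
        rw [← Real.rpow_add hnR]; congr 1; ring
      calc (n : ℝ) ^ (-(θ / 4)) * Real.log n ≤ (n : ℝ) ^ (-(θ / 4)) * ((n : ℝ) ^ (θ / 8) / (θ / 8)) :=
            mul_le_mul_of_nonneg_left hl8 (Real.rpow_pos_of_pos hnR _).le
        _ = (n : ℝ) ^ (-(θ / 8)) * (8 / θ) := by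
            rw [mul_div_assoc', e, div_div_eq_mul_div]
            ring
    have h2 : (n : ℝ) ^ (-(θ / 8)) * (8 / θ) ≤ ε / 2 := by
      have := mul_le_mul_of_nonneg_right hs1 (show (0 : ℝ) ≤ 8 / θ by positivity)
      refine this.trans (le_of_eq ?_)
      field_simp
      ring
    calc (n : ℝ) * (n : ℝ) ^ (-(θ / 4)) * Real.log n = n * ((n : ℝ) ^ (-(θ / 4)) * Real.log n) := by ring
      _ ≤ n * (ε / 2) := mul_le_mul_of_nonneg_left (h1.trans h2) hnR.le
      _ = ε / 2 * n := by ring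
  -- (b) `2 n r₀ log n ≤ (ε/2) n`
  have hB : (n : ℝ) * (2 * r₀) * Real.log n ≤ ε / 2 * n := by
    have h1 : (n : ℝ) * r₀ ≤ (2 * k + 1) / q * (n : ℝ) ^ θ := by
      calc (n : ℝ) * r₀ ≤ n * ((2 * k + 1) * (n : ℝ) ^ (-(1 - θ)) / q) :=
            mul_le_mul_of_nonneg_left hr hnR.le
        _ = (2 * k + 1) / q * ((n : ℝ) * (n : ℝ) ^ (-(1 - θ))) := by ring
        _ = (2 * k + 1) / q * (n : ℝ) ^ θ := by
            congr 1
            rw [show (n : ℝ) * (n : ℝ) ^ (-(1 - θ)) = (n : ℝ) ^ ((1 : ℝ) + -(1 - θ)) by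
              rw [Real.rpow_add hnR, Real.rpow_one]]
            congr 1; ring
    have h2 : (n : ℝ) ^ θ * Real.log n ≤ 2 * (n : ℝ) ^ (θ + 1 / 2) := by
      calc (n : ℝ) ^ θ * Real.log n ≤ (n : ℝ) ^ θ * ((n : ℝ) ^ (1 / 2 : ℝ) / (1 / 2)) :=
            mul_le_mul_of_nonneg_left hl2 (Real.rpow_pos_of_pos hnR _).le
        _ = 2 * (n : ℝ) ^ (θ + 1 / 2) := by
            rw [Real.rpow_add hnR]; ring
    have h3 : (n : ℝ) ^ (θ + 1 / 2) ≤ (n : ℝ) ^ (-(1 / 4 : ℝ)) * n := by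
      rw [show (n : ℝ) ^ (-(1 / 4 : ℝ)) * n = (n : ℝ) ^ (-(1 / 4 : ℝ) + 1) by
        rw [Real.rpow_add hnR, Real.rpow_one]]
      exact Real.rpow_le_rpow_of_exponent_le hn1.le (by linarith)
    have h4 : (2 * k + 1) / q * (2 * ((n : ℝ) ^ (-(1 / 4 : ℝ)) * n)) ≤ ε / 4 * n := by
      have h := mul_le_mul_of_nonneg_left hs2 (show (0 : ℝ) ≤ 2 * (2 * k + 1) / q * n by positivity)
      have e : 2 * (2 * k + 1) / q * n * (ε * q / (16 * (2 * k + 1))) = ε * n / 8 := by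
        field_simp
        norm_num
      rw [e] at h
      have hεn : 0 ≤ ε * n := by positivity
      calc (2 * k + 1) / q * (2 * ((n : ℝ) ^ (-(1 / 4 : ℝ)) * n))
          = 2 * (2 * k + 1) / q * n * (n : ℝ) ^ (-(1 / 4 : ℝ)) := by ring
        _ ≤ ε * n / 8 := h
        _ ≤ ε / 4 * n := by linarith
    calc (n : ℝ) * (2 * r₀) * Real.log n = 2 * ((n : ℝ) * r₀) * Real.log n := by ring
      _ ≤ 2 * ((2 * k + 1) / q * (n : ℝ) ^ θ) * Real.log n := by
          apply mul_le_mul_of_nonneg_right _ hlogpos.le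
          linarith
      _ = 2 * ((2 * k + 1) / q) * ((n : ℝ) ^ θ * Real.log n) := by ring
      _ ≤ 2 * ((2 * k + 1) / q) * (2 * (n : ℝ) ^ (θ + 1 / 2)) :=
          mul_le_mul_of_nonneg_left h2 (by positivity)
      _ ≤ 2 * ((2 * k + 1) / q) * (2 * ((n : ℝ) ^ (-(1 / 4 : ℝ)) * n)) := by
          apply mul_le_mul_of_nonneg_left _ (by positivity)
          linarith
      _ = 2 * ((2 * k + 1) / q * (2 * ((n : ℝ) ^ (-(1 / 4 : ℝ)) * n))) := by ring
      _ ≤ 2 * (ε / 4 * n) := by linarith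
      _ = ε / 2 * n := by ring
  -- (c) `(ℓ T + ℓ + 3) log n ≤ ε n`
  have hC : (ℓ * T + ℓ + 3) * Real.log n ≤ ε * n := by
    have hpow1 : (1 : ℝ) ≤ (n : ℝ) ^ (1 - θ) := Real.one_le_rpow hn1.le (by linarith)
    have h1 : ℓ * T + ℓ + 3 ≤ 12 * k * (n : ℝ) ^ (1 - θ) * Real.log n := by
      have hℓ' : ℓ ≤ 3 * Real.log n := by linarith
      have hT' : ℓ * T ≤ 3 * Real.log n * (2 * k * (n : ℝ) ^ (1 - θ)) :=
        mul_le_mul hℓ' hT hT0 (by positivity)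
      have hX : 1 ≤ k * (n : ℝ) ^ (1 - θ) := one_le_mul_of_one_le_of_one_le hk hpow1
      have hP : Real.log n ≤ k * (n : ℝ) ^ (1 - θ) * Real.log n :=
        le_mul_of_one_le_left hlogpos.le hX
      have e1 : 3 * Real.log n * (2 * k * (n : ℝ) ^ (1 - θ)) =
          6 * (k * (n : ℝ) ^ (1 - θ) * Real.log n) := by ring
      rw [e1] at hT'
      have e2 : 12 * k * (n : ℝ) ^ (1 - θ) * Real.log n = 12 * (k * (n : ℝ) ^ (1 - θ) * Real.log n) := by
        ring
      rw [e2]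
      linarith
    have h2 : Real.log n ^ 2 ≤ (16 / θ ^ 2) * (n : ℝ) ^ (θ / 2) := by
      have hl0 : 0 ≤ Real.log n := hlogpos.le
      calc Real.log n ^ 2 ≤ ((n : ℝ) ^ (θ / 4) / (θ / 4)) ^ 2 := pow_le_pow_left₀ hl0 hl4 2
        _ = (16 / θ ^ 2) * (n : ℝ) ^ (θ / 2) := by
            rw [div_pow, ← Real.rpow_natCast ((n : ℝ) ^ (θ / 4)) 2, ← Real.rpow_mul hnR.le]
            field_simp
            ring_nf
    have h3 : 12 * k * (n : ℝ) ^ (1 - θ) * Real.log n * Real.log n ≤ ε * n := by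
      have e : (n : ℝ) ^ (1 - θ) * (n : ℝ) ^ (θ / 2) = (n : ℝ) ^ (-(θ / 2)) * n := by
        rw [← Real.rpow_add hnR, show (n : ℝ) ^ (-(θ / 2)) * n = (n : ℝ) ^ (-(θ / 2) + 1) by
          rw [Real.rpow_add hnR, Real.rpow_one]]
        congr 1; ring
      calc 12 * k * (n : ℝ) ^ (1 - θ) * Real.log n * Real.log n
          = 12 * k * (n : ℝ) ^ (1 - θ) * Real.log n ^ 2 := by ring
        _ ≤ 12 * k * (n : ℝ) ^ (1 - θ) * ((16 / θ ^ 2) * (n : ℝ) ^ (θ / 2)) :=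
            mul_le_mul_of_nonneg_left h2 (by positivity)
        _ = 192 * k / θ ^ 2 * ((n : ℝ) ^ (1 - θ) * (n : ℝ) ^ (θ / 2)) := by ring
        _ = 192 * k / θ ^ 2 * ((n : ℝ) ^ (-(θ / 2)) * n) := by rw [e]
        _ ≤ 192 * k / θ ^ 2 * (ε * θ ^ 2 / (192 * k) * n) := by
            apply mul_le_mul_of_nonneg_left _ (by positivity)
            exact mul_le_mul_of_nonneg_right hs3 hnR.le
        _ = ε * n := by field_simp
    calc (ℓ * T + ℓ + 3) * Real.log n ≤ 12 * k * (n : ℝ) ^ (1 - θ) * Real.log n * Real.log n :=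
          mul_le_mul_of_nonneg_right h1 hlogpos.le
      _ ≤ ε * n := h3
  calc ((n : ℝ) * ((n : ℝ) ^ (-(θ / 4)) + 2 * r₀) + (ℓ * T + ℓ + 3)) * Real.log n
      = (n : ℝ) * (n : ℝ) ^ (-(θ / 4)) * Real.log n + (n : ℝ) * (2 * r₀) * Real.log n +
          (ℓ * T + ℓ + 3) * Real.log n := by ring
    _ ≤ ε / 2 * n + ε / 2 * n + ε * n := add_le_add (add_le_add hA hB) hC
    _ = ε / 2 * n * 4 := by ring

/-- **The probability factor.** [folklore] -/
theorem prob_factor_le {n k : ℕ} {Tc X C θ : ℝ} (hn : 1 ≤ n) (hθ0 : 0 ≤ θ) (hTc0 : 0 ≤ Tc)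
    (hTc : Tc ≤ 2 * k * (n : ℝ) ^ (1 - θ)) (hX : (C + k + 2) * Real.log n ≤ X)
    (hs : (n : ℝ) ^ (-(1 : ℝ)) ≤ 1 / (8 * k * 2 ^ k + 1)) :
    4 * ((n : ℝ) + 1) ^ k * Tc * Real.exp (-X) ≤ (n : ℝ) ^ (-C) := by
  have hnR : (0 : ℝ) < n := by exact_mod_cast (show 0 < n by omega)
  have hn1 : (1 : ℝ) ≤ n := by exact_mod_cast hn
  have hexp : Real.exp (-X) ≤ (n : ℝ) ^ (-(C + k + 2)) := by
    calc Real.exp (-X) ≤ Real.exp (-((C + k + 2) * Real.log n)) := Real.exp_le_exp.mpr (by linarith)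
      _ = (n : ℝ) ^ (-(C + k + 2)) := by rw [Real.rpow_def_of_pos hnR]; congr 1; ring
  have hpow : ((n : ℝ) + 1) ^ k ≤ 2 ^ k * (n : ℝ) ^ k := by
    rw [← mul_pow]; exact pow_le_pow_left₀ (by positivity) (by linarith) k
  have hTc' : Tc ≤ 2 * k * n := by
    refine hTc.trans (mul_le_mul_of_nonneg_left ?_ (by positivity))
    calc (n : ℝ) ^ (1 - θ) ≤ (n : ℝ) ^ (1 : ℝ) := Real.rpow_le_rpow_of_exponent_le hn1 (by linarith)
      _ = n := Real.rpow_one _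
  have e1 : (n : ℝ) ^ k * (n : ℝ) * (n : ℝ) ^ (-(C + k + 2)) = (n : ℝ) ^ (-(1 : ℝ)) * (n : ℝ) ^ (-C) := by
    rw [← Real.rpow_natCast, show (n : ℝ) ^ (k : ℝ) * (n : ℝ) = (n : ℝ) ^ (k : ℝ) * (n : ℝ) ^ (1 : ℝ)
      by rw [Real.rpow_one], ← Real.rpow_add hnR, ← Real.rpow_add hnR, ← Real.rpow_add hnR]
    congr 1; ring
  have hposC : (0 : ℝ) ≤ (n : ℝ) ^ (-C) := (Real.rpow_pos_of_pos hnR _).le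
  have hpos1 : (0 : ℝ) ≤ (n : ℝ) ^ (-(C + k + 2)) := (Real.rpow_pos_of_pos hnR _).le
  calc 4 * ((n : ℝ) + 1) ^ k * Tc * Real.exp (-X)
      ≤ 4 * (2 ^ k * (n : ℝ) ^ k) * (2 * k * n) * (n : ℝ) ^ (-(C + k + 2)) := by
        apply mul_le_mul _ hexp (Real.exp_pos _).le (by positivity)
        exact mul_le_mul (mul_le_mul_of_nonneg_left hpow (by norm_num)) hTc' hTc0 (by positivity)
    _ = 8 * k * 2 ^ k * ((n : ℝ) ^ k * (n : ℝ) * (n : ℝ) ^ (-(C + k + 2))) := by ring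
    _ = 8 * k * 2 ^ k * ((n : ℝ) ^ (-(1 : ℝ)) * (n : ℝ) ^ (-C)) := by rw [e1]
    _ ≤ 8 * k * 2 ^ k * ((1 / (8 * k * 2 ^ k + 1)) * (n : ℝ) ^ (-C)) := by
        apply mul_le_mul_of_nonneg_left _ (by positivity)
        exact mul_le_mul_of_nonneg_right hs hposC
    _ ≤ (n : ℝ) ^ (-C) := by
        rw [← mul_assoc]
        apply mul_le_of_le_one_left hposC
        rw [mul_one_div, div_le_one (by positivity)]
        linarith

/-- **The Chernoff exponent is large.** With `δ = n^{−θ/4}`, `T₂ = ⌊(J−1)/2⌋`,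
`J = ⌊(n−1)/(ℓ+1)⌋`, `p ≥ 1/(2k q^ℓ)`, `q^ℓ ≤ n^{1−θ}`, `ℓ + 1 ≤ 3 log n` and two smallness
conditions: `(C + k + 2) log n ≤ δ² T₂ p / 4`. [folklore] -/
theorem exponent_ge {n k ℓ : ℕ} {C θ : ℝ} (hn : 1 ≤ n) (hk : 2 ≤ k) (hθ : 0 < θ)
    (hC : 0 ≤ C) (hlog : 1 ≤ Real.log n) (hℓ3 : (ℓ : ℝ) + 1 ≤ 3 * Real.log n)
    (hqℓ : (2 * k - 1 : ℝ) ^ ℓ ≤ (n : ℝ) ^ (1 - θ))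
    (hs4 : (n : ℝ) ^ (-(1 / 2 : ℝ)) ≤ 1 / 50)
    (hs5 : (n : ℝ) ^ (-(θ / 4)) ≤ θ ^ 2 / (6144 * k * (C + k + 2))) :
    (C + k + 2) * Real.log n ≤ ((n : ℝ) ^ (-(θ / 4))) ^ 2 *
      (((((n - 1) / (ℓ + 1) - 1) / 2 : ℕ) : ℝ) * (((2 * k - 1 : ℝ) ^ (ℓ + 2) + 2 * k + 1) /
        (2 * k * (2 * k - 1 : ℝ) ^ (ℓ + 1 + (ℓ + 1))))) / 4 := by
  have hnR : (0 : ℝ) < n := by exact_mod_cast (show 0 < n by omega)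
  have hn1R : (1 : ℝ) ≤ n := by exact_mod_cast hn
  have hk2 : (2 : ℝ) ≤ k := by exact_mod_cast hk
  have hq1 : (1 : ℝ) ≤ 2 * k - 1 := by linarith
  have hqpos : (0 : ℝ) < 2 * k - 1 := by linarith
  have hlogpos : 0 < Real.log n := by linarith
  set J := (n - 1) / (ℓ + 1) with hJ
  set T₂ := (J - 1) / 2 with hT₂
  set p : ℝ := ((2 * k - 1 : ℝ) ^ (ℓ + 2) + 2 * k + 1) /
    (2 * k * (2 * k - 1 : ℝ) ^ (ℓ + 1 + (ℓ + 1))) with hp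
  -- `p ≥ 1/(2k n^{1-θ})`
  have hpge : 1 / (2 * k * (n : ℝ) ^ (1 - θ)) ≤ p := by
    have h1 : 1 / (2 * k * (n : ℝ) ^ (1 - θ)) ≤ 1 / (2 * k * (2 * k - 1 : ℝ) ^ ℓ) := by
      apply one_div_le_one_div_of_le (by positivity)
      exact mul_le_mul_of_nonneg_left hqℓ (by positivity)
    refine h1.trans ?_
    rw [hp, div_le_div_iff₀ (by positivity) (by positivity), one_mul]
    have e : (2 * k - 1 : ℝ) ^ (ℓ + 1 + (ℓ + 1)) = (2 * k - 1 : ℝ) ^ ℓ * (2 * k - 1 : ℝ) ^ (ℓ + 2) := by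
      rw [← pow_add]; congr 1; omega
    rw [e]
    have : (0 : ℝ) ≤ 2 * k * (2 * k - 1 : ℝ) ^ ℓ * (2 * k + 1) := by positivity
    nlinarith
  -- `T₂ ≥ (n-1)/(2(ℓ+1)) - 2`
  have hJge : ((n : ℝ) - 1) / ((ℓ : ℝ) + 1) - 1 ≤ (J : ℝ) := by
    have h := natDiv_ge (n - 1) (ℓ + 1) (by omega)
    push_cast [Nat.cast_sub hn] at h
    exact h
  have hT₂ge : ((n : ℝ) - 1) / (2 * ((ℓ : ℝ) + 1)) - 2 ≤ (T₂ : ℝ) := by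
    have h := natDiv_ge (J - 1) 2 (by norm_num)
    have h2 : (J : ℝ) - 1 ≤ ((J - 1 : ℕ) : ℝ) := by
      have : J ≤ (J - 1) + 1 := le_tsub_add
      have := (Nat.cast_le (α := ℝ)).mpr this
      push_cast at this
      linarith
    push_cast at h
    have : ((n : ℝ) - 1) / (2 * ((ℓ : ℝ) + 1)) = (((n : ℝ) - 1) / ((ℓ : ℝ) + 1)) / 2 := by
      rw [div_div, mul_comm]
    rw [this]
    linarith
  -- `(n-1)/(2(ℓ+1)) - 2 ≥ n/(12 log n)`
  have hsqrt : (50 : ℝ) ≤ (n : ℝ) ^ (1 / 2 : ℝ) := by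
    have hpos : (0 : ℝ) < (n : ℝ) ^ (1 / 2 : ℝ) := Real.rpow_pos_of_pos hnR _
    have e : (n : ℝ) ^ (-(1 / 2 : ℝ)) = ((n : ℝ) ^ (1 / 2 : ℝ))⁻¹ := Real.rpow_neg hnR.le _
    rw [e, inv_le_comm₀ hpos (by norm_num)] at hs4
    simpa using hs4
  have hl2 : Real.log n ≤ (n : ℝ) ^ (1 / 2 : ℝ) / (1 / 2) := Real.log_le_rpow_div hnR.le (by norm_num)
  have hnsq : (n : ℝ) = (n : ℝ) ^ (1 / 2 : ℝ) * (n : ℝ) ^ (1 / 2 : ℝ) := by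
    rw [← Real.rpow_add hnR]; norm_num
  have hbig : (n : ℝ) / (12 * Real.log n) ≤ ((n : ℝ) - 1) / (2 * ((ℓ : ℝ) + 1)) - 2 := by
    have hℓpos : (0 : ℝ) < (ℓ : ℝ) + 1 := by positivity
    -- `(n-1)/(2(ℓ+1)) ≥ (n-1)/(6 log n)` and `(n-1)/(6 log n) - 2 ≥ n/(12 log n)` iff `n - 2 ≥ 24 log n`
    have h1 : ((n : ℝ) - 1) / (6 * Real.log n) ≤ ((n : ℝ) - 1) / (2 * ((ℓ : ℝ) + 1)) := by
      apply div_le_div_of_nonneg_left (by linarith) (by positivity)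
      linarith
    have h2 : 24 * Real.log n ≤ (n : ℝ) - 2 := by
      have : 24 * Real.log n ≤ 48 * (n : ℝ) ^ (1 / 2 : ℝ) := by linarith
      nlinarith [hsqrt, Real.rpow_pos_of_pos hnR (1 / 2 : ℝ)]
    have h3 : (n : ℝ) / (12 * Real.log n) ≤ ((n : ℝ) - 1) / (6 * Real.log n) - 2 := by
      rw [div_le_iff₀ (by positivity)]
      have e : (((n : ℝ) - 1) / (6 * Real.log n) - 2) * (12 * Real.log n) =
          2 * ((n : ℝ) - 1) - 24 * Real.log n := by
        field_simp
        ring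
      rw [e]
      linarith
    linarith
  -- assemble: `δ² T₂ p ≥ n^{-θ/2} · n/(12 log n) · 1/(2k n^{1-θ}) = n^{θ/2}/(24 k log n)`
  have hδ2 : ((n : ℝ) ^ (-(θ / 4))) ^ 2 = (n : ℝ) ^ (-(θ / 2)) := by
    rw [← Real.rpow_natCast, ← Real.rpow_mul hnR.le]; congr 1; push_cast; ring
  have hT₂pos : (0 : ℝ) ≤ (T₂ : ℝ) := Nat.cast_nonneg _
  have hprod : (n : ℝ) ^ (θ / 2) / (24 * k * Real.log n) ≤
      (n : ℝ) ^ (-(θ / 2)) * ((T₂ : ℝ) * p) := by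
    have hA : (n : ℝ) / (12 * Real.log n) * (1 / (2 * k * (n : ℝ) ^ (1 - θ))) ≤ (T₂ : ℝ) * p :=
      mul_le_mul (hbig.trans hT₂ge) hpge (by positivity) hT₂pos
    have e : (n : ℝ) ^ (θ / 2) / (24 * k * Real.log n) =
        (n : ℝ) ^ (-(θ / 2)) * ((n : ℝ) / (12 * Real.log n) * (1 / (2 * k * (n : ℝ) ^ (1 - θ)))) := by
      have e2 : (n : ℝ) ^ (θ / 2) = (n : ℝ) ^ (-(θ / 2)) * n * ((n : ℝ) ^ (1 - θ))⁻¹ := by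
        rw [← Real.rpow_neg hnR.le, show (n : ℝ) ^ (-(θ / 2)) * n * (n : ℝ) ^ (-(1 - θ)) =
          (n : ℝ) ^ (-(θ / 2)) * (n : ℝ) ^ (1 : ℝ) * (n : ℝ) ^ (-(1 - θ)) by rw [Real.rpow_one],
          ← Real.rpow_add hnR, ← Real.rpow_add hnR]
        congr 1; ring
      rw [e2]
      field_simp
      norm_num
    rw [e]
    exact mul_le_mul_of_nonneg_left hA (Real.rpow_pos_of_pos hnR _).le
  -- `n^{θ/2}/(24 k log n) ≥ 4 (C+k+2) log n`
  have hl8 : Real.log n ≤ (n : ℝ) ^ (θ / 8) / (θ / 8) := Real.log_le_rpow_div hnR.le (by positivity)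
  have hlog2 : Real.log n ^ 2 ≤ (64 / θ ^ 2) * (n : ℝ) ^ (θ / 4) := by
    calc Real.log n ^ 2 ≤ ((n : ℝ) ^ (θ / 8) / (θ / 8)) ^ 2 := pow_le_pow_left₀ hlogpos.le hl8 2
      _ = (64 / θ ^ 2) * (n : ℝ) ^ (θ / 4) := by
          rw [div_pow, ← Real.rpow_natCast ((n : ℝ) ^ (θ / 8)) 2, ← Real.rpow_mul hnR.le]
          field_simp
          ring_nf
  have hCk : (0 : ℝ) < C + k + 2 := by linarith
  have hfin : 4 * ((C + k + 2) * Real.log n) ≤ (n : ℝ) ^ (θ / 2) / (24 * k * Real.log n) := by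
    rw [le_div_iff₀ (by positivity)]
    -- `96 k (C+k+2) log² n ≤ n^{θ/2}`
    have h1 : 96 * k * (C + k + 2) * Real.log n ^ 2 ≤ 96 * k * (C + k + 2) * ((64 / θ ^ 2) * (n : ℝ) ^ (θ / 4)) :=
      mul_le_mul_of_nonneg_left hlog2 (by positivity)
    have h2 : 96 * k * (C + k + 2) * ((64 / θ ^ 2) * (n : ℝ) ^ (θ / 4)) ≤ (n : ℝ) ^ (θ / 2) := by
      -- from `hs5`: `6144 k (C+k+2)/θ² ≤ n^{θ/4}` and `n^{θ/4} n^{θ/4} = n^{θ/2}`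
      have e : (n : ℝ) ^ (θ / 2) = (n : ℝ) ^ (θ / 4) * (n : ℝ) ^ (θ / 4) := by
        rw [← Real.rpow_add hnR]; congr 1; ring
      have hq : 6144 * k * (C + k + 2) / θ ^ 2 ≤ (n : ℝ) ^ (θ / 4) := by
        have hpos : (0 : ℝ) < (n : ℝ) ^ (θ / 4) := Real.rpow_pos_of_pos hnR _
        have e2 : (n : ℝ) ^ (-(θ / 4)) = ((n : ℝ) ^ (θ / 4))⁻¹ := Real.rpow_neg hnR.le _
        rw [e2, inv_le_comm₀ hpos (by positivity), inv_div] at hs5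
        exact hs5
      rw [e]
      have hpos : (0 : ℝ) ≤ (n : ℝ) ^ (θ / 4) := (Real.rpow_pos_of_pos hnR _).le
      calc 96 * k * (C + k + 2) * ((64 / θ ^ 2) * (n : ℝ) ^ (θ / 4))
          = (6144 * k * (C + k + 2) / θ ^ 2) * (n : ℝ) ^ (θ / 4) := by ring
        _ ≤ (n : ℝ) ^ (θ / 4) * (n : ℝ) ^ (θ / 4) := mul_le_mul_of_nonneg_right hq hpos
    calc 4 * ((C + k + 2) * Real.log n) * (24 * k * Real.log n)
        = 96 * k * (C + k + 2) * Real.log n ^ 2 := by ring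
      _ ≤ _ := h1.trans h2
  rw [hδ2]
  have := hfin.trans hprod
  linarith

end Asymptotics

section FinalHelpers

/-- `r₀ = (2k+1)/q^{ℓ+2} ≤ 1/4` for `k ≥ 2`, `ℓ ≥ 1`. [folklore] -/
theorem r0_le_quarter {k : ℝ} (hk : 2 ≤ k) {ℓ : ℕ} (hℓ : 1 ≤ ℓ) :
    (2 * k + 1) / (2 * k - 1) ^ (ℓ + 2) ≤ 1 / 4 := by
  have hq1 : (1 : ℝ) ≤ 2 * k - 1 := by linarith
  rw [div_le_div_iff₀ (by positivity) (by norm_num), one_mul]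
  have h3 : (2 * k - 1 : ℝ) ^ 3 ≤ (2 * k - 1 : ℝ) ^ (ℓ + 2) := pow_le_pow_right₀ hq1 (by omega)
  have hu2 : (9 : ℝ) ≤ (2 * k - 1) ^ 2 := by nlinarith
  have e3 : (2 * k - 1 : ℝ) ^ 3 = (2 * k - 1) * (2 * k - 1) ^ 2 := by ring
  have h4 : (2 * k + 1) * 4 ≤ (2 * k - 1 : ℝ) ^ 3 := by rw [e3]; nlinarith
  linarith

/-- `r₀ ≤ (2k+1) n^{−(1−θ)}/q` when `n^{1−θ} ≤ q^{ℓ+1}`. [folklore] -/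
theorem r0_le_rpow {k θ : ℝ} {n : ℕ} (hn : 1 ≤ n) (hk : 1 ≤ k) {ℓ : ℕ}
    (hnL : (n : ℝ) ^ (1 - θ) ≤ (2 * k - 1) ^ (ℓ + 1)) :
    (2 * k + 1) / (2 * k - 1) ^ (ℓ + 2) ≤ (2 * k + 1) * (n : ℝ) ^ (-(1 - θ)) / (2 * k - 1) := by
  have hnR : (0 : ℝ) < n := by exact_mod_cast (show 0 < n by omega)
  have hqpos : (0 : ℝ) < 2 * k - 1 := by linarith
  have hpow : (0 : ℝ) < (n : ℝ) ^ (1 - θ) := Real.rpow_pos_of_pos hnR _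
  rw [Real.rpow_neg hnR.le, div_le_div_iff₀ (by positivity) hqpos, pow_succ]
  have h2 : 1 ≤ ((n : ℝ) ^ (1 - θ))⁻¹ * (2 * k - 1 : ℝ) ^ (ℓ + 1) := by
    rw [← div_eq_inv_mul, one_le_div hpow]; exact hnL
  have h0 : (0 : ℝ) ≤ (2 * k + 1) * (2 * k - 1) := by
    have : (0 : ℝ) ≤ 2 * k + 1 := by linarith
    positivity
  calc (2 * k + 1) * (2 * k - 1 : ℝ) = (2 * k + 1) * (2 * k - 1) * 1 := by ring
    _ ≤ (2 * k + 1) * (2 * k - 1) * (((n : ℝ) ^ (1 - θ))⁻¹ * (2 * k - 1 : ℝ) ^ (ℓ + 1)) :=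
        mul_le_mul_of_nonneg_left h2 h0
    _ = (2 * k + 1) * ((n : ℝ) ^ (1 - θ))⁻¹ * ((2 * k - 1 : ℝ) ^ (ℓ + 1) * (2 * k - 1)) := by ring

/-- `ℓ + 1 ≤ n` from `ℓ + 1 ≤ 3 log n` and `√n ≥ 50`. [folklore] -/
theorem ell_add_one_le {n : ℕ} {x : ℝ} (hn : 1 ≤ n) (hx : x ≤ 3 * Real.log n)
    (hs4 : (n : ℝ) ^ (-(1 / 2 : ℝ)) ≤ 1 / 50) : x ≤ n := by
  have hnR : (0 : ℝ) < n := by exact_mod_cast (show 0 < n by omega)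
  have hpos : (0 : ℝ) < (n : ℝ) ^ (1 / 2 : ℝ) := Real.rpow_pos_of_pos hnR _
  have hsqrt : (50 : ℝ) ≤ (n : ℝ) ^ (1 / 2 : ℝ) := by
    have e : (n : ℝ) ^ (-(1 / 2 : ℝ)) = ((n : ℝ) ^ (1 / 2 : ℝ))⁻¹ := Real.rpow_neg hnR.le _
    rw [e, inv_le_comm₀ hpos (by norm_num)] at hs4
    simpa using hs4
  have hl2 : Real.log n ≤ (n : ℝ) ^ (1 / 2 : ℝ) / (1 / 2) := Real.log_le_rpow_div hnR.le (by norm_num)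
  have hnsq : (n : ℝ) = (n : ℝ) ^ (1 / 2 : ℝ) * (n : ℝ) ^ (1 / 2 : ℝ) := by
    rw [← Real.rpow_add hnR]; norm_num
  have h6 : 6 * (n : ℝ) ^ (1 / 2 : ℝ) ≤ (n : ℝ) ^ (1 / 2 : ℝ) * (n : ℝ) ^ (1 / 2 : ℝ) :=
    mul_le_mul_of_nonneg_right (by linarith) hpos.le
  have h7 : Real.log n ≤ 2 * (n : ℝ) ^ (1 / 2 : ℝ) := by
    rw [div_eq_mul_inv] at hl2; norm_num at hl2; linarith
  linarith

/-- `J = ⌊(n−1)/(ℓ+1)⌋` versus `(n−1)/(ℓ+1)`. [folklore] -/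
theorem chunkNumber_bounds (n ℓ : ℕ) (hn : 1 ≤ n) :
    (n : ℝ) - 1 - ℓ ≤ (((n - 1) / (ℓ + 1) : ℕ) : ℝ) * ((ℓ : ℝ) + 1) ∧
      (((n - 1) / (ℓ + 1) : ℕ) : ℝ) ≤ ((n : ℝ) - 1) / ((ℓ : ℝ) + 1) := by
  have hn1R : ((n - 1 : ℕ) : ℝ) = n - 1 := by push_cast [Nat.cast_sub hn]; ring
  constructor
  · have h := Nat.div_add_mod (n - 1) (ℓ + 1)
    have hm := Nat.mod_lt (n - 1) (show 0 < ℓ + 1 by omega)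
    have h' : n - 1 ≤ (ℓ + 1) * ((n - 1) / (ℓ + 1)) + ℓ := by omega
    have := (Nat.cast_le (α := ℝ)).mpr h'
    rw [hn1R] at this
    push_cast at this
    linarith
  · have := Nat.cast_div_le (α := ℝ) (m := n - 1) (n := ℓ + 1)
    rw [hn1R] at this
    push_cast at this
    exact this

end FinalHelpers

section Final

/-- **Random rigidity, upper tail with constant `1/4` (weak form of CW Thm 4.1's upper bound).**
For `k ≥ 2`, `ε > 0`, `C > 1` there is `K` with, for all large `n`,
`#{v ∈ F_n' : scl(v) log n / n > log(2k−1)/4 + ε} ≤ K n^{−C} |F_n'|`.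
(Calegari–Walker prove the sharp constant `1/6` by gluing tripods and rectangles, Prop. 4.2;
the chunk fatgraph used here wastes a factor `3/2`.) Together with
`CalegariWalker2013_sclLowerTail`: `scl` of a random element of `F_n'` is `≍ n / log n`.
[cite: CalegariWalker2013, Thm 4.1 / Prop. 4.2 (weak form)] -/
theorem CalegariWalker2013_sclUpperTail_quarter (k : ℕ) (hk : 2 ≤ k) (ε : ℝ) (hε : 0 < ε)
    (C : ℝ) (hC : 1 < C) :
    ∃ K : ℝ, ∀ᶠ n : ℕ in atTop,
      ((((commutatorWords k n).filter fun w =>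
          Real.log (2 * k - 1) / 4 + ε <
            stableCommutatorLength (FreeGroup.mk (List.ofFn w)) * Real.log n / n).card : ℕ) : ℝ) ≤
        K * (n : ℝ) ^ (-C) * ((commutatorWords k n).card : ℝ) := by
  -- constants
  have hk2 : (2 : ℝ) ≤ k := by exact_mod_cast hk
  have hk1 : (1 : ℝ) ≤ k := by linarith
  have hq3 : (3 : ℝ) ≤ 2 * k - 1 := by linarith
  have hqpos : (0 : ℝ) < 2 * k - 1 := by linarith
  have hlq : 1 < Real.log (2 * k - 1) :=
    one_lt_log_three.trans_le (Real.log_le_log (by norm_num) hq3)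
  have hlq0 : 0 < Real.log (2 * k - 1) := by linarith
  set θ : ℝ := min (1 / 4) (ε / Real.log (2 * k - 1)) with hθdef
  have hθpos : 0 < θ := lt_min (by norm_num) (div_pos hε hlq0)
  have hθ4 : θ ≤ 1 / 4 := min_le_left _ _
  have hθε : θ * Real.log (2 * k - 1) ≤ ε := by
    have h : θ ≤ ε / Real.log (2 * k - 1) := min_le_right _ _
    rwa [le_div_iff₀ hlq0] at h
  have hCk : (0 : ℝ) < C + k + 2 := by linarith
  refine ⟨1, ?_⟩
  filter_upwards [card_filter_scl_gt_le k hk,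
    eventually_windowLength' (L := 1 - θ) hq3 (by linarith) (by linarith),
    eventually_rpow_neg_le (c := θ / 8) (B := ε * θ / 16) (by positivity) (by positivity),
    eventually_rpow_neg_le (c := 1 / 4) (B := ε * (2 * k - 1) / (16 * (2 * k + 1)))
      (by norm_num) (by positivity),
    eventually_rpow_neg_le (c := θ / 2) (B := ε * θ ^ 2 / (192 * k)) (by positivity) (by positivity),
    eventually_rpow_neg_le (c := 1 / 2) (B := 1 / 50) (by norm_num) (by norm_num),
    eventually_rpow_neg_le (c := θ / 4) (B := min (1 / 2) (θ ^ 2 / (6144 * k * (C + k + 2))))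
      (by positivity) (lt_min (by norm_num) (by positivity)),
    eventually_rpow_neg_le (c := 1) (B := 1 / (8 * k * 2 ^ k + 1)) (by norm_num) (by positivity),
    Filter.eventually_ge_atTop 1] with n hper hwin hs1 hs2 hs3 hs4 hs5 hs6 hn1
  obtain ⟨hℓ1, hℓle, hℓ3, hlog1, hnL, hqℓ⟩ := hwin
  rcases Nat.even_or_odd n with heven | hodd
  swap
  · rw [commutatorWords_eq_empty_of_odd k hodd]
    simp
  have hnR : (0 : ℝ) < n := by exact_mod_cast (show 0 < n by omega)
  have hlogpos : 0 < Real.log n := by linarith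
  -- the parameters for this `n`
  set ℓ : ℕ := ⌊(1 - θ) * Real.log n / Real.log (2 * k - 1)⌋₊ with hℓdef
  have hlt : (1 - θ) * Real.log n / Real.log (2 * k - 1) < (ℓ : ℝ) + 1 := Nat.lt_floor_add_one _
  set δ : ℝ := (n : ℝ) ^ (-(θ / 4)) with hδdef
  have hδ0 : 0 ≤ δ := (Real.rpow_pos_of_pos hnR _).le
  have hδhalf : δ ≤ 1 / 2 := hs5.trans (min_le_left _ _)
  have hs5' : (n : ℝ) ^ (-(θ / 4)) ≤ θ ^ 2 / (6144 * k * (C + k + 2)) := hs5.trans (min_le_right _ _)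
  have hmain := hper heven ℓ δ hδ0 (by linarith)
  clear hper
  set J : ℕ := (n - 1) / (ℓ + 1) with hJdef
  set T₂ : ℕ := ((n - 1) / (ℓ + 1) - 1) / 2 with hT₂def
  set p : ℝ := ((2 * k - 1 : ℝ) ^ (ℓ + 2) + 2 * k + 1) /
    (2 * k * (2 * k - 1 : ℝ) ^ (ℓ + 1 + (ℓ + 1))) with hpdef
  set T : ℝ := ((reducedWords k (ℓ + 1)).card : ℝ) with hTdef
  set r₀ : ℝ := (2 * k + 1) / (2 * k - 1 : ℝ) ^ (ℓ + 2) with hr₀def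
  have hT0 : 0 ≤ T := Nat.cast_nonneg _
  have hTeq : T = 2 * k * (2 * k - 1 : ℝ) ^ ℓ := by
    rw [hTdef, card_reducedWords k (by omega : 1 ≤ ℓ + 1)]
    push_cast [Nat.cast_sub (show 1 ≤ 2 * k by omega)]
    simp
  have hTle : T ≤ 2 * k * (n : ℝ) ^ (1 - θ) := by
    rw [hTeq]; exact mul_le_mul_of_nonneg_left hqℓ (by positivity)
  have hTp : T * p = 1 + r₀ := card_types_mul_p k ℓ (by omega)
  have hr0 : 0 ≤ r₀ := by rw [hr₀def]; positivity
  have hr₀le : r₀ ≤ (2 * k + 1) * (n : ℝ) ^ (-(1 - θ)) / (2 * k - 1) := r0_le_rpow hn1 hk1 hnL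
  have hr₀q : r₀ ≤ 1 / 4 := r0_le_quarter hk2 hℓ1
  have hℓn : (ℓ : ℝ) + 1 ≤ n := ell_add_one_le hn1 hℓ3 hs4
  obtain ⟨hJ1, hJ2⟩ := chunkNumber_bounds n ℓ hn1
  -- the threshold
  have hB := perLength_bound_le (n := (n : ℝ)) (ℓ := (ℓ : ℝ)) (Jr := (J : ℝ)) (T := T) (pp := p)
    hδ0 hr0 (by linarith) (Nat.cast_nonneg ℓ) hℓn (Nat.cast_nonneg J) hJ1 hJ2 hTp
  have hmainT := threshold_main_le (n := (n : ℝ)) (ℓ := (ℓ : ℝ)) hnR.le hlogpos hlq0 hθpos hθ4 hθε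
    (Nat.cast_nonneg ℓ) hlt
  have herr := error_terms_le (n := n) (ℓ := (ℓ : ℝ)) (T := T) (r₀ := r₀) (q := 2 * k - 1) hk1 hq3
    hθpos hθ4 hε hlog1 hℓ3 hT0 hTle hr₀le hs1 hs2 hs3
  have hthr : ((n : ℝ) + 2 + ℓ * T * (1 + (1 + δ) * ((J : ℝ) * p)) - 2 * ℓ * (J : ℝ)) / 4 ≤
      (Real.log (2 * k - 1) / 4 + ε) * n / Real.log n := by
    have h1 : ((n : ℝ) - 1) / ((ℓ : ℝ) + 1) ≤ n / ((ℓ : ℝ) + 1) :=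
      div_le_div_of_nonneg_right (by linarith) (by positivity)
    have e : (Real.log (2 * k - 1) / 4 + ε) * n / Real.log n =
        (Real.log (2 * k - 1) / 4 + ε / 2) * n / Real.log n + ε / 2 * n / Real.log n := by
      field_simp
      ring
    rw [e]
    have h2 : (n : ℝ) / ((ℓ : ℝ) + 1) / 4 = n / (4 * ((ℓ : ℝ) + 1)) := by
      rw [div_div, mul_comm]
    have hδr : (n : ℝ) * (δ + 2 * r₀) / 4 + ((ℓ : ℝ) * T + ℓ + 3) / 4 ≤ ε / 2 * n / Real.log n := herr
    linarith
  -- the inclusion of events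
  have hsub : ((commutatorWords k n).filter fun w =>
      Real.log (2 * k - 1) / 4 + ε <
        stableCommutatorLength (FreeGroup.mk (List.ofFn w)) * Real.log n / n) ⊆
      (commutatorWords k n).filter fun w =>
        ((n : ℝ) + 2 + ℓ * T * (1 + (1 + δ) * ((J : ℝ) * p)) - 2 * ℓ * (J : ℝ)) / 4 <
          stableCommutatorLength (FreeGroup.mk (List.ofFn w)) := by
    intro w hw
    rw [Finset.mem_filter] at hw ⊢
    refine ⟨hw.1, lt_of_le_of_lt hthr ?_⟩
    have h := hw.2
    rw [lt_div_iff₀ hnR] at h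
    rw [div_lt_iff₀ hlogpos]
    linarith
  -- the probability factor
  have hX := exponent_ge (n := n) (k := k) (ℓ := ℓ) (C := C) (θ := θ) hn1 hk hθpos (by linarith)
    hlog1 hℓ3 hqℓ hs4 hs5'
  have hprob := prob_factor_le (n := n) (k := k) (Tc := T) (C := C) (θ := θ)
    (X := δ ^ 2 * ((T₂ : ℝ) * p) / 4) hn1 hθpos.le hT0 hTle hX hs6
  calc ((((commutatorWords k n).filter fun w =>
        Real.log (2 * k - 1) / 4 + ε <
          stableCommutatorLength (FreeGroup.mk (List.ofFn w)) * Real.log n / n).card : ℕ) : ℝ)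
      ≤ ((((commutatorWords k n).filter fun w =>
          ((n : ℝ) + 2 + ℓ * T * (1 + (1 + δ) * ((J : ℝ) * p)) - 2 * ℓ * (J : ℝ)) / 4 <
            stableCommutatorLength (FreeGroup.mk (List.ofFn w))).card : ℕ) : ℝ) :=
        (Nat.cast_le (α := ℝ)).mpr (Finset.card_le_card hsub)
    _ ≤ 4 * ((n : ℝ) + 1) ^ k * T * Real.exp (-(δ ^ 2 * ((T₂ : ℝ) * p) / 4)) *
          ((commutatorWords k n).card : ℝ) := hmain
    _ ≤ 1 * (n : ℝ) ^ (-C) * ((commutatorWords k n).card : ℝ) := by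
        rw [one_mul ((n : ℝ) ^ (-C))]
        exact mul_le_mul_of_nonneg_right hprob (Nat.cast_nonneg _)

/-- **Order of magnitude of scl of a random word (weak two-sided form of CW Thm 4.1).** For
`k ≥ 2`, `ε > 0`, `C > 1` there is `K` with, for all large `n`, all but at most `K n^{−C} |F_n'|`
words `v ∈ F_n'` satisfy `log(2k−1)/12 − ε ≤ scl(v) log n / n ≤ log(2k−1)/4 + ε`.
(CW Thm 4.1: both constants are `1/6`.) [cite: CalegariWalker2013, Thm 4.1 (weak form)] -/
theorem CalegariWalker2013_sclOrderOfMagnitude (k : ℕ) (hk : 2 ≤ k) (ε : ℝ) (hε : 0 < ε)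
    (C : ℝ) (hC : 1 < C) :
    ∃ K : ℝ, ∀ᶠ n : ℕ in atTop,
      ((((commutatorWords k n).filter fun w =>
          stableCommutatorLength (FreeGroup.mk (List.ofFn w)) * Real.log n / n <
              Real.log (2 * k - 1) / 12 - ε ∨
            Real.log (2 * k - 1) / 4 + ε <
              stableCommutatorLength (FreeGroup.mk (List.ofFn w)) * Real.log n / n).card : ℕ) : ℝ) ≤
        K * (n : ℝ) ^ (-C) * ((commutatorWords k n).card : ℝ) := by
  classical
  obtain ⟨K₁, h₁⟩ := CalegariWalker2013_sclLowerTail k hk ε hε C hC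
  obtain ⟨K₂, h₂⟩ := CalegariWalker2013_sclUpperTail_quarter k hk ε hε C hC
  refine ⟨K₁ + K₂, ?_⟩
  filter_upwards [h₁, h₂] with n hn₁ hn₂
  rw [Finset.filter_or]
  refine le_trans ((Nat.cast_le (α := ℝ)).mpr (Finset.card_union_le _ _)) ?_
  push_cast
  have e : (K₁ + K₂) * (n : ℝ) ^ (-C) * ((commutatorWords k n).card : ℝ) =
      K₁ * (n : ℝ) ^ (-C) * ((commutatorWords k n).card : ℝ) +
        K₂ * (n : ℝ) ^ (-C) * ((commutatorWords k n).card : ℝ) := by ring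
  rw [e]
  exact add_le_add hn₁ hn₂

end Final




end Literature.GroupTheory.CombinatorialGroupTheory

end
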